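import Literature.Barriers.CriticalPhenomena.RigorousRGSmallParameterFRDScalingKernel
import Literature.Barriers.CriticalPhenomena.RigorousRGSmallParameterCovarianceDecomposition
import HarnessLib

/-!
# `RigorousRGSmallParameter` (Slade, Theorem 1.4.1): Lemma 10.3.1 — asymptotic self-similarity
# of the covariance decomposition, `C_j(x;m²) = L^{-(d-α)j}(c₀(L^{-j}x, m²L^{αj}) + O(L^{-j}))`

Fourth file of the §10.3 layer (after `…FRDContinuumApproximation`, `…FRDSelfSimilarity`,
`…FRDScalingKernel`), and the first covariance-level consequence of (10.38): the input of Lemma 5.2.2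
("By Lemma 10.3.1, `C_{k;0,x} = c_k(x) + O(L^{-pk})` with `c_k(x) = L^{-(d-α)k}c₀(L^{-k}x)`") and,
through `c₀`, of Lemma 10.3.2 and Lemma 5.2.3 — hence of the coupling-constant bounds of Lemma 5.2.4
that the critical RG flow (`RigorousRGSmallParameterCriticalFlow.lean`) takes as hypotheses.

Source: G. Slade, *Critical exponents for long-range `O(n)` models below the upper critical
dimension*, Commun. Math. Phys. **358** (2018) 343–436, §10.3. "We define a smooth function
`c₀ : ℝ^d × [0,∞) → ℝ`, with compact support in `ℝ^d`, by (10.40) `c₀(x,m²) = ∫_0^∞dσ ρ(σ,m²)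
∫_{½L^{-1}}^{½}(dτ/τ)(c/τ)^{d-2}w̄(cx/τ, στ²)`. … **Lemma 10.3.1.** Let `d ≥ 1`, `α ∈ (0, 2∧d)`, and
`m² ∈ [0,m̄²]`. As `j → ∞`, (10.41) `C_{j;0,x}(m²) = L^{-(d-α)j}(c₀(L^{-j}x, m²L^{αj}) + O(L^{-j}))`, with
the constant in the error estimate uniform in `x ∈ ℤ^d`, but possibly `m̄²`- and `L`-dependent.
*Proof.* Since we are interested in the limit `j → ∞`, we assume that `j ≥ 2` to avoid the special case
of `C_1`. By (3.8), `C_{j;0,x}(m²) = ∫_0^∞ds ρ(s,m²)∫_{J_j}(dt/t)w(t,x;s)`. The analysis of `T_{j,3}` in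
the proof of Proposition 10.1.1 shows that the contribution to the `s`-integral from `s ≥ 1` can be
absorbed into the error term in (10.41), and similar estimates show that the same is true for the
contribution to the right-hand side of (10.41) from the portion of the integral (10.40) due to `s ≥ 1`.
The error estimate in (10.38) is uniform in `s ≤ 1`, and thus it suffices to prove that
`∫_0^1ds ρ(s,m²)∫_{J_j}(dt/t)t^{-(d-1)}(1+st²)^{-p} = O(L^{-(d-α+1)j})`. This follows from estimates
like those used previously, using `ρ(s,m²) ≲ s^{-α/2}`. □"

## Normalisation (ours vs Slade's)

`C_j = FRD.fracCov d L α m² j` is `∫_0^∞ Γ_j(x;s)ρ^{(α/2)}(s,m²)ds` ((3.8)), `Γ_j = ∫_{J_j}w dt/t`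
(`J_j = (½L^{j-1}, ½L^j]`, `j ≥ 2`) with the explicit [Baue13a]/BBS kernel `w = FRD.wKer`. By
`FRD.abs_wKer_sub_wKerCont0_le` ((10.38)) and `FRD.wKerCont0_eq_scaling`,
`w(t,x;s) = (M₀/t)^d(t²/(2dc))w̄(M₀x/t; st²/(2d)) + O(t^{1-d}(1+t²s/(2d+s))^{-p})` for `s ≤ 1`, `t ≥ 1`,
`M₀ = √(2d)`, `c = cProfile`; accordingly
`c₀(y,A) := ∫_0^∞dσ ρ^{(α/2)}(σ,A)∫_{(1/(2L),1/2]}(dτ/τ)(M₀/τ)^d(τ²/(2dc))w̄(M₀y/τ; στ²/(2d))`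
(`FRD.cZero`; Slade's (10.40) with his unspecified constant `c` equal to `M₀` and his implicit
normalisation made explicit). The substitutions are `t = L^jτ` and `s = σL^{-2j}`, under which
`ρ^{(β)}(σL^{-2j}, m²)d(σL^{-2j}) = L^{-2j}L^{αj}ρ^{(β)}(σ, m²L^{αj})dσ` (`Kato.katoDensity_mul_left`),
producing the factor `L^{-(d-α)j}` and the second argument `m²L^{αj}`.

## What this file proves (everything; three definitions, no named fact)

* `Kato.katoDensity_mul_left` — scaling of Kato's density `ρ^{(β)}(λσ,a) = λ^{-β}ρ^{(β)}(σ,aλ^{-β})`.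
* `FRD.cZeroIntegrand`, `FRD.cZeroKer` (the `τ`-integral `G_L(y,σ)`), **`FRD.cZero`** (Slade's `c₀`);
  measurability (`measurable_wbar₂`, `measurable_wbar_param`, `measurable_cZeroIntegrand(_right)`,
  `measurable_cZeroKer`, `measurable_wKerCont0_t`); the decay `FRD.abs_cZeroKer_le`
  (`|G_L(y,σ)| ≤ K(1+σ/(8dL²))^{-p}`, from (10.39)); `katoDensity_le_const_mul_rpow_neg`;
  `integrableOn_rpow_neg_mul_inv`, `setIntegral_rpow_neg_mul_inv_le`
  (`∫_0^1 s^{-β}(1+Bs)^{-1} ≤ (1/(1-β)+1/β)B^{β-1}`).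
* `FRD.integrableOn_cZeroKer_mul_katoDensity`, `FRD.abs_setIntegral_Ioi_cZeroKer_mul_le` (the
  large-`σ` tail of `c₀` is `O(R^{-1-β})`); `FRD.integrableOn_Gam_mul_katoDensity_of_two_le`
  (`s ↦ Γ_j(s)ρ(s,m²)` integrable for `j ≥ 2` and ALL `m²`, including `m² = 0`);
  `FRD.integrableOn_wKerCont0_div_Ioc`.
* The changes of variables `FRD.setIntegral_wKerCont0_div_eq` (`∫_{(Λ/2L,Λ/2]}w₀dt/t =
  (Λ²/Λ^d)G_L(x/Λ, sΛ²)`) and `FRD.setIntegral_comp_mul_katoDensity_eq`.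
* The error terms `FRD.abs_setIntegral_Ioi_one_Gam_mul_le` (`s ≥ 1`: `O(ℓ^{-2-d})`) and
  `FRD.abs_setIntegral_Ioc_selfSimilarError_le` (`s ≤ 1`: `O((L-1)ℓ^{α-d-1})`), `ℓ = L^{j-1}`.
* **`FRD.Slade2017_lem1031`** — **Lemma 10.3.1, PROVED**: for `d ≥ 1`, `α ∈ (0,2)`, `L ≥ 2` there is
  `C(d,α,L)` with `|C_j(x;m²) - (L^j)^{α-d}c₀(x/L^j, m²(L^j)^α)| ≤ C(L^j)^{α-d}(L^j)⁻¹` for all `j ≥ 2`,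
  all real `m²` and all `x ∈ ℤ^d`.

Scope. The hypothesis `α < d` of the paper is not needed here; the mass is unrestricted (the paper's
`m² ∈ [0,m̄²]`) because every estimate uses only `ρ(s,m²) ≤ s^{-α/2}/(π sin(πα/2))`. Not in this file:
the smoothness / compact support of `c₀` in `y`, the Fourier positivity (10.40)/(10.40'), Lemma 10.3.2.
-/

noncomputable section

namespace Literature.Barriers.CriticalPhenomena

open _root_.MeasureTheory Set Filter
open scoped _root_.Topology Real FourierTransform

namespace LongRangePhi4

/-! ### Scaling of Kato's density -/

/-- **Scaling of Kato's density**: `ρ^{(β)}(λσ, a) = λ^{-β}ρ^{(β)}(σ, aλ^{-β})` for `λ, σ > 0` — the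
substitution `s = σL^{-2j}` turns `ρ(s,m²)ds` into `L^{-2j(1-β)}ρ(σ, m²L^{αj})dσ`, which is where the
second argument `m²L^{αj}` of `c₀` in (10.41) comes from. [cite: Slade2017, §2.1.2 (display (2.10), the formula for ρ^{(β)})] [cite: Slade2017, Lemma 10.3.1 (display (10.41): c₀(L^{-j}x, m²L^{αj}))] -/
theorem Kato.katoDensity_mul_left {β : ℝ} (hβ0 : 0 < β) (hβ1 : β < 1) (a : ℝ) {lam : ℝ}
    (hlam : 0 < lam) {σ : ℝ} (hσ : 0 < σ) :
    Kato.katoDensity β a (lam * σ) = lam ^ (-β) * Kato.katoDensity β (a * lam ^ (-β)) σ := by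
  have hD := Kato.katoDenom_pos hβ0 hβ1 (a * lam ^ (-β)) hσ
  set lb : ℝ := lam ^ β with hlb
  have hlb0 : 0 < lb := Real.rpow_pos_of_pos hlam β
  have hneg : lam ^ (-β) = lb⁻¹ := by rw [hlb, Real.rpow_neg hlam.le]
  have h1 : (lam * σ) ^ β = lb * σ ^ β := by rw [Real.mul_rpow hlam.le hσ.le]
  have h2 : (lam * σ) ^ (2 * β) = lb ^ 2 * σ ^ (2 * β) := by
    rw [Real.mul_rpow hlam.le hσ.le, mul_comm (2 : ℝ) β, Real.rpow_mul hlam.le, hlb]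
    norm_num
  rw [hneg] at hD ⊢
  unfold Kato.katoDensity
  rw [h1, h2]
  have hsb : 0 < σ ^ β := Real.rpow_pos_of_pos hσ β
  have hden : lb ^ 2 * σ ^ (2 * β) + a ^ 2 + 2 * a * (lb * σ ^ β) * Real.cos (π * β) =
      lb ^ 2 * (σ ^ (2 * β) + (a * lb⁻¹) ^ 2 + 2 * (a * lb⁻¹) * σ ^ β * Real.cos (π * β)) := by
    field_simp
  rw [hden]
  field_simp


namespace FRD

open Literature.Probability.LatticeModels

variable {d : ℕ}


/-! ### The scaling function `c₀` -/

/-- The integrand of the inner kernel of `c₀`: `(M₀/τ)^d (τ²/(2dc)) w̄(M₀y/τ; στ²/(2d))/τ`, `M₀ = √(2d)`.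
[cite: Slade2017, §10.3 (display (10.40), the τ-integrand)] -/
def cZeroIntegrand (d : ℕ) (y : Fin d → ℝ) (σ τ : ℝ) : ℝ :=
  (Real.sqrt (2 * d) / τ) ^ d * (τ ^ 2 / (cProfile * (2 * d))) *
    wbar d (σ * τ ^ 2 / (2 * d)) (fun i => Real.sqrt (2 * d) * y i / τ) / τ

/-- **The inner kernel of `c₀`**: `G_L(y,σ) = ∫_{(1/(2L), 1/2]} (M₀/τ)^d (τ²/(2dc)) w̄(M₀y/τ; στ²/(2d)) dτ/τ`,
`M₀ = √(2d)` — the `τ`-integral of (10.40) in our normalisation (`(c/τ)^{d-2}w̄(cx/τ, στ²)` with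
`c = M₀`, normalising constant `cProfile⁻¹`, second argument `στ²/M₀²`).
[cite: Slade2017, §10.3 (display (10.40), the τ-integral)] -/
def cZeroKer (d : ℕ) (L : ℝ) (y : Fin d → ℝ) (σ : ℝ) : ℝ :=
  ∫ τ in Ioc (1 / (2 * L)) (1 / 2), cZeroIntegrand d y σ τ

/-- **Slade's `c₀` (10.40)** in our normalisation:
`c₀(y, A) = ∫_0^∞ dσ ρ^{(α/2)}(σ, A) ∫_{1/(2L)}^{1/2} (dτ/τ)(M₀/τ)^d(τ²/(2dc)) w̄(M₀y/τ; στ²/(2d))` — "We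
define a smooth function `c₀ : ℝ^d × [0,∞) → ℝ`, with compact support in `ℝ^d`, by (10.40)
`c₀(x,m²) = ∫_0^∞dσ ρ(σ,m²)∫_{½L^{-1}}^{½}(dτ/τ)(c/τ)^{d-2}w̄(cx/τ, στ²)`."
[cite: Slade2017, §10.3 (display (10.40))] -/
def cZero (d : ℕ) (L α : ℝ) (y : Fin d → ℝ) (A : ℝ) : ℝ :=
  ∫ σ in Ioi 0, cZeroKer d L y σ * Kato.katoDensity (α / 2) A σ

/-! ### Measurability -/

/-- Joint measurability of `(σ, y) ↦ w̄(y;σ)` (a parametric integral of a continuous integrand).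
[folklore] -/
theorem measurable_wbar₂ : Measurable fun q : ℝ × (Fin d → ℝ) => wbar d q.1 q.2 := by
  have hsq : Continuous (sqNorm : (Fin d → ℝ) → ℝ) := by
    unfold sqNorm
    fun_prop
  have hc : Continuous fun r : (ℝ × (Fin d → ℝ)) × (Fin d → ℝ) =>
      (profile (Real.sqrt (sqNorm r.2 + r.1.1))).re * Real.cos (∑ i, r.2 i * r.1.2 i) := by
    refine (Complex.continuous_re.comp (profile.continuous.comp
      ((hsq.comp continuous_snd).add (continuous_fst.comp continuous_fst)).sqrt)).mul
      (Real.continuous_cos.comp ?_)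
    refine continuous_finsetSum _ fun i _ => ?_
    exact ((continuous_apply i).comp continuous_snd).mul
      ((continuous_apply i).comp (continuous_snd.comp continuous_fst))
  have h := (hc.measurable.stronglyMeasurable.integral_prod_right'
    (ν := (volume : Measure (Fin d → ℝ)))).measurable
  unfold wbar
  exact h.const_mul _

/-- Joint measurability of `(σ,τ) ↦ w̄(M₀y/τ; στ²/(2d))` (a parametric integral of a measurable
integrand). [folklore] -/
theorem measurable_wbar_param (y : Fin d → ℝ) :
    Measurable fun q : ℝ × ℝ => wbar d (q.1 * q.2 ^ 2 / (2 * d)) (fun i => Real.sqrt (2 * d) * y i / q.2) := by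
  have hsq : Measurable (sqNorm : (Fin d → ℝ) → ℝ) := by
    have : Continuous (sqNorm : (Fin d → ℝ) → ℝ) := by
      unfold sqNorm
      fun_prop
    exact this.measurable
  have harg : Measurable fun r : (ℝ × ℝ) × (Fin d → ℝ) => sqNorm r.2 + r.1.1 * r.1.2 ^ 2 / (2 * d) :=
    (hsq.comp measurable_snd).add (((measurable_fst.comp measurable_fst).mul
      ((measurable_snd.comp measurable_fst).pow_const 2)).div_const _)
  have hph : Measurable fun r : (ℝ × ℝ) × (Fin d → ℝ) => ∑ i, r.2 i * (Real.sqrt (2 * d) * y i / r.1.2) := by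
    refine Finset.measurable_sum _ fun i _ => ?_
    exact ((measurable_pi_apply i).comp measurable_snd).mul
      (measurable_const.div (measurable_snd.comp measurable_fst))
  have hm : Measurable fun r : (ℝ × ℝ) × (Fin d → ℝ) =>
      (profile (Real.sqrt (sqNorm r.2 + r.1.1 * r.1.2 ^ 2 / (2 * d)))).re *
        Real.cos (∑ i, r.2 i * (Real.sqrt (2 * d) * y i / r.1.2)) :=
    (Complex.measurable_re.comp (profile.continuous.measurable.comp
      (Real.continuous_sqrt.measurable.comp harg))).mul (Real.measurable_cos.comp hph)
  have h := (hm.stronglyMeasurable.integral_prod_right'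
    (ν := (volume : Measure (Fin d → ℝ)))).measurable
  unfold wbar
  exact h.const_mul _

/-- Joint measurability of `(σ,τ) ↦` the integrand of `G_L`. [folklore] -/
theorem measurable_cZeroIntegrand (y : Fin d → ℝ) :
    Measurable fun q : ℝ × ℝ => cZeroIntegrand d y q.1 q.2 := by
  have hW := measurable_wbar_param (d := d) y
  have hP : Measurable fun q : ℝ × ℝ => (Real.sqrt (2 * d) / q.2) ^ d * (q.2 ^ 2 / (cProfile * (2 * d))) :=
    ((measurable_const.div measurable_snd).pow_const d).mul ((measurable_snd.pow_const 2).div_const _)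
  have h3 : Measurable fun q : ℝ × ℝ => (Real.sqrt (2 * d) / q.2) ^ d * (q.2 ^ 2 / (cProfile * (2 * d))) *
      wbar d (q.1 * q.2 ^ 2 / (2 * d)) (fun i => Real.sqrt (2 * d) * y i / q.2) / q.2 :=
    (hP.mul hW).div measurable_snd
  unfold cZeroIntegrand
  exact h3

/-- Measurability of `σ ↦ G_L(y,σ)`. [folklore] -/
theorem measurable_cZeroKer (L : ℝ) (y : Fin d → ℝ) : Measurable fun σ : ℝ => cZeroKer d L y σ := by
  have h := ((measurable_cZeroIntegrand (d := d) y).stronglyMeasurable.integral_prod_right'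
    (ν := (volume : Measure ℝ).restrict (Ioc (1 / (2 * L)) (1 / 2)))).measurable
  unfold cZeroKer
  exact h

/-- Measurability of `τ ↦` the integrand of `G_L` at fixed `σ`. [folklore] -/
theorem measurable_cZeroIntegrand_right (y : Fin d → ℝ) (σ : ℝ) :
    Measurable fun τ : ℝ => cZeroIntegrand d y σ τ :=
  (measurable_cZeroIntegrand y).comp (measurable_const.prodMk measurable_id)

/-- Measurability of `t ↦ w₀(t,x;s)` (a parametric integral of a continuous integrand). [folklore] -/
theorem measurable_wKerCont0_t (s : ℝ) (x : Site d) : Measurable fun t : ℝ => wKerCont0 d s t x := by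
  have hsq : Continuous (sqNorm : (Fin d → ℝ) → ℝ) := by
    unfold sqNorm
    fun_prop
  have hc : Continuous fun r : ℝ × (Fin d → ℝ) => wHatCont0 d s r.1 r.2 * Real.cos (phase r.2 x) := by
    unfold wHatCont0
    refine ((((continuous_fst.pow 2).div_const _)).mul (Complex.continuous_re.comp
      (profile.continuous.comp (continuous_fst.mul
        (((hsq.comp continuous_snd).add continuous_const).div_const _).sqrt)))).mul
      (Real.continuous_cos.comp ((continuous_phase x).comp continuous_snd))
  have h := (hc.measurable.stronglyMeasurable.integral_prod_right'
    (ν := (volume : Measure (Fin d → ℝ)))).measurable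
  unfold wKerCont0
  exact h.const_mul _

/-! ### Bounds on `G_L` and on Kato's density -/

/-- **Decay of the inner kernel** (from (10.39)): for `d ≥ 1`, `L ≥ 1` and every `p` there is
`K(d,p,L)` with `|G_L(y,σ)| ≤ K(1 + σ/(8dL²))^{-p}` for all `σ ≥ 0`, `y` (on the `τ`-interval,
`τ² ≥ 1/(4L²)` and the prefactor `(M₀/τ)^d(τ²/(2dc))/τ` is bounded).
[cite: Slade2017, §10.3 (displays (10.39)–(10.40))] -/
theorem abs_cZeroKer_le (hd : 1 ≤ d) {L : ℝ} (hL : 1 ≤ L) (p : ℕ) :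
    ∃ K : ℝ, 0 < K ∧ ∀ σ : ℝ, 0 ≤ σ → ∀ y : Fin d → ℝ,
      IntegrableOn (fun τ : ℝ => cZeroIntegrand d y σ τ) (Ioc (1 / (2 * L)) (1 / 2)) ∧
      |cZeroKer d L y σ| ≤ K * ((1 + σ / (8 * d * L ^ 2)) ^ p)⁻¹ := by
  have hd' : (1 : ℝ) ≤ d := by exact_mod_cast hd
  have hc := cProfile_pos
  obtain ⟨C, hC, hw⟩ := abs_wbar_le hd p
  have hM0 : 0 < Real.sqrt (2 * d) := Real.sqrt_pos.2 (by positivity)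
  have hL0 : 0 < L := by linarith
  -- the bound of the prefactor on `τ ∈ (1/(2L), 1/2]`
  obtain ⟨P, hP⟩ : ∃ P : ℝ, P = (Real.sqrt (2 * d) * (2 * L)) ^ d * (1 / (cProfile * (2 * d))) * (2 * L) :=
    ⟨_, rfl⟩
  have hP0 : 0 < P := by rw [hP]; positivity
  have hpref : ∀ τ ∈ Ioc (1 / (2 * L)) (1 / 2 : ℝ),
      0 ≤ (Real.sqrt (2 * d) / τ) ^ d * (τ ^ 2 / (cProfile * (2 * d))) / τ ∧
      (Real.sqrt (2 * d) / τ) ^ d * (τ ^ 2 / (cProfile * (2 * d))) / τ ≤ P := by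
    intro τ hτ
    have hτ0 : 0 < τ := lt_trans (by positivity) hτ.1
    refine ⟨by positivity, ?_⟩
    have hinvτ : τ⁻¹ ≤ 2 * L := by
      rw [inv_le_comm₀ hτ0 (by positivity)]
      have := hτ.1
      rw [one_div] at this
      exact this.le
    have ha : (Real.sqrt (2 * d) / τ) ^ d ≤ (Real.sqrt (2 * d) * (2 * L)) ^ d := by
      apply pow_le_pow_left₀ (by positivity)
      rw [div_eq_mul_inv]
      exact mul_le_mul_of_nonneg_left hinvτ hM0.le
    have hb : τ ^ 2 / (cProfile * (2 * d)) ≤ 1 / (cProfile * (2 * d)) := by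
      apply div_le_div_of_nonneg_right _ (by positivity)
      nlinarith [hτ.2]
    rw [div_eq_mul_inv, hP]
    exact mul_le_mul (mul_le_mul ha hb (by positivity) (by positivity)) hinvτ (by positivity)
      (by positivity)
  refine ⟨P * C * (1 / 2) + 1, by positivity, fun σ hσ y => ?_⟩
  have hpt : ∀ τ ∈ Ioc (1 / (2 * L)) (1 / 2 : ℝ),
      |cZeroIntegrand d y σ τ| ≤ P * C * ((1 + σ / (8 * d * L ^ 2)) ^ p)⁻¹ := by
    intro τ hτ
    have hτ0 : 0 < τ := lt_trans (by positivity) hτ.1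
    have hσ' : 0 ≤ σ * τ ^ 2 / (2 * d) := by positivity
    have h1 := hw _ hσ' (fun i => Real.sqrt (2 * d) * y i / τ)
    -- `(1 + στ²/(2d))^{-p} ≤ (1 + σ/(8dL²))^{-p}`
    have h2 : ((1 + σ * τ ^ 2 / (2 * d)) ^ p)⁻¹ ≤ ((1 + σ / (8 * d * L ^ 2)) ^ p)⁻¹ := by
      apply inv_anti₀ (by positivity)
      apply pow_le_pow_left₀ (by positivity)
      have hτsq : 1 / (4 * L ^ 2) ≤ τ ^ 2 := by
        have h := pow_le_pow_left₀ (by positivity : (0 : ℝ) ≤ 1 / (2 * L)) hτ.1.le 2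
        calc 1 / (4 * L ^ 2) = (1 / (2 * L)) ^ 2 := by field_simp; ring
          _ ≤ τ ^ 2 := h
      have h3 : σ / (8 * d * L ^ 2) ≤ σ * τ ^ 2 / (2 * d) := by
        have e : σ / (8 * d * L ^ 2) = σ * (1 / (4 * L ^ 2)) / (2 * d) := by
          field_simp
          ring
        rw [e]
        exact div_le_div_of_nonneg_right (mul_le_mul_of_nonneg_left hτsq hσ) (by positivity)
      linarith
    obtain ⟨hq0, hq⟩ := hpref τ hτ
    have e : cZeroIntegrand d y σ τ =
        ((Real.sqrt (2 * d) / τ) ^ d * (τ ^ 2 / (cProfile * (2 * d))) / τ) *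
          wbar d (σ * τ ^ 2 / (2 * d)) (fun i => Real.sqrt (2 * d) * y i / τ) := by
      unfold cZeroIntegrand
      ring
    rw [e, abs_mul, abs_of_nonneg hq0]
    calc (Real.sqrt (2 * d) / τ) ^ d * (τ ^ 2 / (cProfile * (2 * d))) / τ *
          |wbar d (σ * τ ^ 2 / (2 * d)) (fun i => Real.sqrt (2 * d) * y i / τ)|
        ≤ P * (C * ((1 + σ * τ ^ 2 / (2 * d)) ^ p)⁻¹) := mul_le_mul hq h1 (abs_nonneg _) hP0.le
      _ ≤ P * (C * ((1 + σ / (8 * d * L ^ 2)) ^ p)⁻¹) :=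
          mul_le_mul_of_nonneg_left (mul_le_mul_of_nonneg_left h2 hC.le) hP0.le
      _ = _ := by ring
  have hgi : IntegrableOn (fun _ : ℝ => P * C * ((1 + σ / (8 * d * L ^ 2)) ^ p)⁻¹)
      (Ioc (1 / (2 * L)) (1 / 2 : ℝ)) :=
    (continuous_const.integrableOn_Icc).mono_set Ioc_subset_Icc_self
  have hfi : IntegrableOn (fun τ : ℝ => cZeroIntegrand d y σ τ) (Ioc (1 / (2 * L)) (1 / 2)) :=
    Integrable.mono' hgi (measurable_cZeroIntegrand_right y σ).aestronglyMeasurable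
      ((ae_restrict_iff' measurableSet_Ioc).2
        (Eventually.of_forall fun τ hτ => by rw [Real.norm_eq_abs]; exact hpt τ hτ))
  refine ⟨hfi, ?_⟩
  have hb := abs_setIntegral_le_of_abs_le measurableSet_Ioc hfi hgi hpt
  unfold cZeroKer
  refine hb.trans ?_
  rw [setIntegral_const, smul_eq_mul]
  have hab : 1 / (2 * L) ≤ (1 / 2 : ℝ) := by
    rw [div_le_div_iff₀ (by positivity) (by positivity)]; linarith
  have hlen : volume.real (Ioc (1 / (2 * L)) (1 / 2 : ℝ)) ≤ 1 / 2 := by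
    rw [Real.volume_real_Ioc_of_le hab]
    have : 0 ≤ 1 / (2 * L) := by positivity
    linarith
  have hX : 0 ≤ P * C * ((1 + σ / (8 * d * L ^ 2)) ^ p)⁻¹ := by positivity
  calc volume.real (Ioc (1 / (2 * L)) (1 / 2 : ℝ)) * (P * C * ((1 + σ / (8 * d * L ^ 2)) ^ p)⁻¹)
      ≤ 1 / 2 * (P * C * ((1 + σ / (8 * d * L ^ 2)) ^ p)⁻¹) := mul_le_mul_of_nonneg_right hlen hX
    _ = P * C * (1 / 2) * ((1 + σ / (8 * d * L ^ 2)) ^ p)⁻¹ := by ring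
    _ ≤ (P * C * (1 / 2) + 1) * ((1 + σ / (8 * d * L ^ 2)) ^ p)⁻¹ := by
        have : 0 ≤ ((1 + σ / (8 * d * L ^ 2)) ^ p)⁻¹ := by positivity
        nlinarith

/-- Kato's density is dominated by `s^{-β}` uniformly in the mass: `ρ^{(β)}(s,a) ≤ s^{-β}/(π sin πβ)`
("using `ρ(s,m²) ≲ s^{-α/2}`"). [cite: Slade2017, §10.3 (proof of Lemma 10.3.1: "using ρ(s,m²) ≲ s^{-α/2}")] -/
theorem katoDensity_le_const_mul_rpow_neg {β : ℝ} (hβ0 : 0 < β) (hβ1 : β < 1) (a : ℝ) {s : ℝ}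
    (hs : 0 < s) : Kato.katoDensity β a s ≤ (π * Real.sin (π * β))⁻¹ * s ^ (-β) := by
  have h := (Kato.katoDensity_le hβ0 hβ1 a hs).1
  rw [div_eq_mul_inv, mul_comm] at h
  exact h

/-- `s ↦ s^{-β}(1+Bs)^{-1}` is integrable on `(0,1]`, nonnegative and `≤ s^{-β}` (`β < 1`, `B > 0`).
[folklore] -/
theorem integrableOn_rpow_neg_mul_inv {β : ℝ} (hβ1 : β < 1) {B : ℝ} (hB : 0 < B) :
    IntegrableOn (fun s : ℝ => s ^ (-β) * (1 + B * s)⁻¹) (Ioc (0 : ℝ) 1) ∧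
    ∀ s ∈ Ioc (0 : ℝ) 1, 0 ≤ s ^ (-β) * (1 + B * s)⁻¹ ∧ s ^ (-β) * (1 + B * s)⁻¹ ≤ s ^ (-β) := by
  have hr : (-1 : ℝ) < -β := by linarith
  have hint1 : IntegrableOn (fun s : ℝ => s ^ (-β)) (Ioc (0 : ℝ) 1) := CovBound.integrableOn_rpow_Ioc_zero hr zero_le_one
  have hle1 : ∀ s ∈ Ioc (0 : ℝ) 1, s ^ (-β) * (1 + B * s)⁻¹ ≤ s ^ (-β) := by
    intro s hs
    refine mul_le_of_le_one_right (Real.rpow_nonneg hs.1.le _) ?_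
    exact inv_le_one_of_one_le₀ (by nlinarith [hs.1])
  have hnn : ∀ s ∈ Ioc (0 : ℝ) 1, 0 ≤ s ^ (-β) * (1 + B * s)⁻¹ := fun s hs =>
    mul_nonneg (Real.rpow_nonneg hs.1.le _) (inv_nonneg.2 (by nlinarith [hs.1]))
  have hmeas : AEStronglyMeasurable (fun s : ℝ => s ^ (-β) * (1 + B * s)⁻¹)
      ((volume : Measure ℝ).restrict (Ioc 0 1)) :=
    ((measurable_id.pow_const _).mul ((measurable_const.add (measurable_const.mul measurable_id)).inv)).aestronglyMeasurable
  have hint : IntegrableOn (fun s : ℝ => s ^ (-β) * (1 + B * s)⁻¹) (Ioc (0 : ℝ) 1) :=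
    Integrable.mono' hint1 hmeas ((ae_restrict_iff' measurableSet_Ioc).2 (Eventually.of_forall
      fun s hs => by rw [Real.norm_eq_abs, abs_of_nonneg (hnn s hs)]; exact hle1 s hs))
  exact ⟨hint, fun s hs => ⟨hnn s hs, hle1 s hs⟩⟩

/-- `∫_{(0,1]} s^{-β}(1+Bs)^{-1}ds ≤ (1/(1-β) + 1/β)B^{β-1}` for `B > 0`, `β ∈ (0,1)` ("estimates like
those used previously"). [cite: Slade2017, §10.3 (proof of Lemma 10.3.1, last display)] -/
theorem setIntegral_rpow_neg_mul_inv_le {β : ℝ} (hβ0 : 0 < β) (hβ1 : β < 1) {B : ℝ} (hB : 0 < B) :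
    ∫ s in Ioc (0 : ℝ) 1, s ^ (-β) * (1 + B * s)⁻¹ ≤ (1 / (1 - β) + 1 / β) * B ^ (β - 1) := by
  have hr : (-1 : ℝ) < -β := by linarith
  have hI0 : ∫ s in Ioc (0 : ℝ) 1, s ^ (-β) = 1 / (1 - β) := by
    rw [CovBound.setIntegral_rpow_Ioc_zero hr zero_le_one, Real.one_rpow]
    congr 1; ring
  have hint1 : IntegrableOn (fun s : ℝ => s ^ (-β)) (Ioc (0 : ℝ) 1) := CovBound.integrableOn_rpow_Ioc_zero hr zero_le_one
  obtain ⟨hint, hpt⟩ := integrableOn_rpow_neg_mul_inv hβ1 hB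
  have hle1 : ∀ s ∈ Ioc (0 : ℝ) 1, s ^ (-β) * (1 + B * s)⁻¹ ≤ s ^ (-β) := fun s hs => (hpt s hs).2
  have hBpow : 0 < B ^ (β - 1) := Real.rpow_pos_of_pos hB _
  rcases le_or_gt B 1 with hB1 | hB1
  · -- `B ≤ 1`: `∫ ≤ ∫ s^{-β} = 1/(1-β) ≤ (…)B^{β-1}` since `B^{β-1} ≥ 1`
    have h1 : ∫ s in Ioc (0 : ℝ) 1, s ^ (-β) * (1 + B * s)⁻¹ ≤ 1 / (1 - β) := by
      rw [← hI0]
      exact setIntegral_mono_on hint hint1 measurableSet_Ioc hle1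
    have h2 : (1 : ℝ) ≤ B ^ (β - 1) := Real.one_le_rpow_of_pos_of_le_one_of_nonpos hB hB1 (by linarith)
    have h3 : 0 < 1 / (1 - β) := by apply one_div_pos.2; linarith
    have h4 : 0 < 1 / β := one_div_pos.2 hβ0
    nlinarith
  · -- `B > 1`: split at `1/B`
    have hB0' : 0 < 1 / B := by positivity
    have hB1' : 1 / B ≤ 1 := by rw [div_le_one hB]; exact hB1.le
    have hsplit : ∫ s in Ioc (0 : ℝ) 1, s ^ (-β) * (1 + B * s)⁻¹ =
        (∫ s in Ioc (0 : ℝ) (1 / B), s ^ (-β) * (1 + B * s)⁻¹) +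
          ∫ s in Ioc (1 / B) 1, s ^ (-β) * (1 + B * s)⁻¹ := by
      rw [← setIntegral_union (Ioc_disjoint_Ioc_of_le le_rfl) measurableSet_Ioc
        (hint.mono_set (Ioc_subset_Ioc_right hB1')) (hint.mono_set (Ioc_subset_Ioc_left hB0'.le)),
        Ioc_union_Ioc_eq_Ioc hB0'.le hB1']
    -- first piece
    have hp1 : ∫ s in Ioc (0 : ℝ) (1 / B), s ^ (-β) * (1 + B * s)⁻¹ ≤ 1 / (1 - β) * B ^ (β - 1) := by
      have hi := CovBound.integrableOn_rpow_Ioc_zero hr hB0'.le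
      calc ∫ s in Ioc (0 : ℝ) (1 / B), s ^ (-β) * (1 + B * s)⁻¹ ≤ ∫ s in Ioc (0 : ℝ) (1 / B), s ^ (-β) :=
            setIntegral_mono_on (hint.mono_set (Ioc_subset_Ioc_right hB1')) hi measurableSet_Ioc
              fun s hs => hle1 s ⟨hs.1, hs.2.trans hB1'⟩
        _ = (1 / B) ^ (-β + 1) / (-β + 1) := CovBound.setIntegral_rpow_Ioc_zero hr hB0'.le
        _ = 1 / (1 - β) * B ^ (β - 1) := by
            rw [one_div, Real.inv_rpow hB.le, ← Real.rpow_neg hB.le]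
            rw [show -(-β + 1) = β - 1 by ring]
            field_simp
            ring
    -- second piece
    have hp2 : ∫ s in Ioc (1 / B) 1, s ^ (-β) * (1 + B * s)⁻¹ ≤ 1 / β * B ^ (β - 1) := by
      have hr2 : (-β - 1 : ℝ) < -1 := by linarith
      have hi2 : IntegrableOn (fun s : ℝ => s ^ (-β - 1)) (Ioi (1 / B)) := integrableOn_Ioi_rpow_of_lt hr2 hB0'
      have hle2 : ∀ s ∈ Ioc (1 / B) 1, s ^ (-β) * (1 + B * s)⁻¹ ≤ B⁻¹ * s ^ (-β - 1) := by
        intro s hs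
        have hs0 : 0 < s := lt_trans hB0' hs.1
        have h1 : (1 + B * s)⁻¹ ≤ (B * s)⁻¹ := inv_anti₀ (by positivity) (by linarith)
        calc s ^ (-β) * (1 + B * s)⁻¹ ≤ s ^ (-β) * (B * s)⁻¹ :=
              mul_le_mul_of_nonneg_left h1 (Real.rpow_nonneg hs0.le _)
          _ = B⁻¹ * s ^ (-β - 1) := by
              rw [Real.rpow_sub hs0, Real.rpow_one, mul_inv]
              field_simp
      calc ∫ s in Ioc (1 / B) 1, s ^ (-β) * (1 + B * s)⁻¹ ≤ ∫ s in Ioc (1 / B) 1, B⁻¹ * s ^ (-β - 1) :=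
            setIntegral_mono_on (hint.mono_set (Ioc_subset_Ioc_left hB0'.le))
              ((hi2.mono_set Ioc_subset_Ioi_self).const_mul _) measurableSet_Ioc hle2
        _ ≤ ∫ s in Ioi (1 / B), B⁻¹ * s ^ (-β - 1) :=
            setIntegral_mono_set (hi2.const_mul _) ((ae_restrict_iff' measurableSet_Ioi).2
              (Eventually.of_forall fun s hs => mul_nonneg (inv_nonneg.2 hB.le)
                (Real.rpow_nonneg (le_of_lt (lt_trans hB0' hs)) _)))
              (Eventually.of_forall Ioc_subset_Ioi_self)
        _ = B⁻¹ * (-(1 / B) ^ (-β - 1 + 1) / (-β - 1 + 1)) := by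
            rw [integral_const_mul, integral_Ioi_rpow_of_lt hr2 hB0']
        _ = 1 / β * B ^ (β - 1) := by
            rw [show (-β - 1 + 1 : ℝ) = -β by ring, one_div, Real.inv_rpow hB.le, ← Real.rpow_neg hB.le,
              neg_neg]
            rw [show B ^ (β - 1) = B ^ β * B⁻¹ by rw [Real.rpow_sub hB, Real.rpow_one, div_eq_mul_inv]]
            field_simp
    rw [hsplit]
    nlinarith [hp1, hp2]

/-! ### Integrability of `σ ↦ G_L(y,σ)ρ(σ,A)` and the large-`σ` tail -/

/-- `σ ↦ G_L(y,σ)ρ^{(β)}(σ,A)` is integrable on `(0,∞)` (majorants `Kc s^{-β}` on `(0,1]` and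
`Kc b^{-2}s^{-2-β}` on `(1,∞)`). [cite: Slade2017, §10.3 (display (10.40))] -/
theorem integrableOn_cZeroKer_mul_katoDensity (hd : 1 ≤ d) {L : ℝ} (hL : 1 ≤ L) {β : ℝ}
    (hβ0 : 0 < β) (hβ1 : β < 1) (A : ℝ) (y : Fin d → ℝ) :
    IntegrableOn (fun σ : ℝ => cZeroKer d L y σ * Kato.katoDensity β A σ) (Ioi 0) := by
  have hd' : (1 : ℝ) ≤ d := by exact_mod_cast hd
  obtain ⟨K, hK, hG⟩ := abs_cZeroKer_le hd hL 2
  set cK : ℝ := (π * Real.sin (π * β))⁻¹ with hcK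
  have hsin : 0 < Real.sin (π * β) := Real.sin_pos_of_pos_of_lt_pi (by positivity)
    (by nlinarith [Real.pi_pos])
  have hcK0 : 0 < cK := by positivity
  set b : ℝ := 1 / (8 * d * L ^ 2) with hb
  have hb0 : 0 < b := by positivity
  have hmeas : AEStronglyMeasurable (fun σ : ℝ => cZeroKer d L y σ * Kato.katoDensity β A σ)
      ((volume : Measure ℝ).restrict (Ioi 0)) :=
    ((measurable_cZeroKer L y).mul (Kato.measurable_katoDensity β A)).aestronglyMeasurable
  have hpt : ∀ σ : ℝ, 0 < σ → |cZeroKer d L y σ * Kato.katoDensity β A σ| ≤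
      K * ((1 + b * σ) ^ 2)⁻¹ * (cK * σ ^ (-β)) := by
    intro σ hσ
    have hρ0 := (Kato.katoDensity_pos hβ0 hβ1 A hσ).le
    rw [abs_mul, abs_of_nonneg hρ0]
    have h1 := (hG σ hσ.le y).2
    have e : σ / (8 * d * L ^ 2) = b * σ := by rw [hb]; ring
    rw [e] at h1
    exact mul_le_mul h1 (katoDensity_le_const_mul_rpow_neg hβ0 hβ1 A hσ) hρ0 (by positivity)
  -- `(0,1]`
  have h01 : IntegrableOn (fun σ : ℝ => cZeroKer d L y σ * Kato.katoDensity β A σ) (Ioc 0 1) := by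
    have hmaj : IntegrableOn (fun σ : ℝ => K * cK * σ ^ (-β)) (Ioc (0 : ℝ) 1) :=
      (CovBound.integrableOn_rpow_Ioc_zero (by linarith : (-1 : ℝ) < -β) zero_le_one).const_mul _
    refine Integrable.mono' hmaj (hmeas.mono_measure (Measure.restrict_mono Ioc_subset_Ioi_self le_rfl))
      ((ae_restrict_iff' measurableSet_Ioc).2 (Eventually.of_forall fun σ hσ => ?_))
    rw [Real.norm_eq_abs]
    refine (hpt σ hσ.1).trans ?_
    have h2 : ((1 + b * σ) ^ 2)⁻¹ ≤ 1 :=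
      inv_le_one_of_one_le₀ (one_le_pow₀ (by nlinarith [mul_pos hb0 hσ.1]))
    have h3 : 0 ≤ cK * σ ^ (-β) := by have := Real.rpow_nonneg hσ.1.le (-β); positivity
    calc K * ((1 + b * σ) ^ 2)⁻¹ * (cK * σ ^ (-β)) ≤ K * 1 * (cK * σ ^ (-β)) := by gcongr
      _ = K * cK * σ ^ (-β) := by ring
  -- `(1,∞)`
  have h1i : IntegrableOn (fun σ : ℝ => cZeroKer d L y σ * Kato.katoDensity β A σ) (Ioi 1) := by
    have hr : (-2 - β : ℝ) < -1 := by linarith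
    have hmaj : IntegrableOn (fun σ : ℝ => K * cK * (b ^ 2)⁻¹ * σ ^ (-2 - β)) (Ioi (1 : ℝ)) :=
      (integrableOn_Ioi_rpow_of_lt hr zero_lt_one).const_mul _
    refine Integrable.mono' hmaj (hmeas.mono_measure (Measure.restrict_mono
      (Ioi_subset_Ioi zero_le_one) le_rfl))
      ((ae_restrict_iff' measurableSet_Ioi).2 (Eventually.of_forall fun σ hσ => ?_))
    have hσ1 : (1 : ℝ) < σ := hσ
    have hσ0 : 0 < σ := by linarith
    rw [Real.norm_eq_abs]
    refine (hpt σ hσ0).trans ?_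
    have h2 : ((1 + b * σ) ^ 2)⁻¹ ≤ (b ^ 2)⁻¹ * σ ^ (-2 : ℝ) := by
      rw [Real.rpow_neg hσ0.le, Real.rpow_two, ← mul_inv, ← mul_pow]
      apply inv_anti₀ (by positivity)
      apply pow_le_pow_left₀ (by positivity)
      linarith
    have h3 : 0 ≤ cK * σ ^ (-β) := by have := Real.rpow_nonneg hσ0.le (-β); positivity
    calc K * ((1 + b * σ) ^ 2)⁻¹ * (cK * σ ^ (-β)) ≤ K * ((b ^ 2)⁻¹ * σ ^ (-2 : ℝ)) * (cK * σ ^ (-β)) := by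
          gcongr
      _ = K * cK * (b ^ 2)⁻¹ * (σ ^ (-2 : ℝ) * σ ^ (-β)) := by ring
      _ = K * cK * (b ^ 2)⁻¹ * σ ^ (-2 - β) := by rw [← Real.rpow_add hσ0]; ring_nf
  have hu := h01.union h1i
  rwa [Ioc_union_Ioi_eq_Ioi zero_le_one] at hu

/-- **The large-`σ` tail of `c₀` is negligible**: for `d ≥ 1`, `L ≥ 1`, `β ∈ (0,1)` there is
`C(d,L,β)` with `|∫_{σ>R} G_L(y,σ)ρ(σ,A)dσ| ≤ C R^{-1-β}` for all `R ≥ 1`, `A`, `y` ("similar estimates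
show that the same is true for the contribution to the right-hand side of (10.41) from the portion of
the integral (10.40) due to" large `s`). [cite: Slade2017, §10.3 (proof of Lemma 10.3.1)] -/
theorem abs_setIntegral_Ioi_cZeroKer_mul_le (hd : 1 ≤ d) {L : ℝ} (hL : 1 ≤ L) {β : ℝ}
    (hβ0 : 0 < β) (hβ1 : β < 1) :
    ∃ C : ℝ, 0 < C ∧ ∀ A : ℝ, ∀ y : Fin d → ℝ, ∀ R : ℝ, 1 ≤ R →
      |∫ σ in Ioi R, cZeroKer d L y σ * Kato.katoDensity β A σ| ≤ C * R ^ (-1 - β) := by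
  have hd' : (1 : ℝ) ≤ d := by exact_mod_cast hd
  obtain ⟨K, hK, hG⟩ := abs_cZeroKer_le hd hL 2
  set cK : ℝ := (π * Real.sin (π * β))⁻¹ with hcK
  have hsin : 0 < Real.sin (π * β) := Real.sin_pos_of_pos_of_lt_pi (by positivity)
    (by nlinarith [Real.pi_pos])
  have hcK0 : 0 < cK := by positivity
  set b : ℝ := 1 / (8 * d * L ^ 2) with hb
  have hb0 : 0 < b := by positivity
  refine ⟨K * cK * (b ^ 2)⁻¹ / (1 + β), by positivity, fun A y R hR => ?_⟩
  have hR0 : 0 < R := by linarith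
  have hr : (-2 - β : ℝ) < -1 := by linarith
  have hmaj : IntegrableOn (fun σ : ℝ => K * cK * (b ^ 2)⁻¹ * σ ^ (-2 - β)) (Ioi R) :=
    (integrableOn_Ioi_rpow_of_lt hr hR0).const_mul _
  have hint := (integrableOn_cZeroKer_mul_katoDensity hd hL hβ0 hβ1 A y).mono_set (Ioi_subset_Ioi hR0.le)
  have hpt : ∀ σ ∈ Ioi R, |cZeroKer d L y σ * Kato.katoDensity β A σ| ≤ K * cK * (b ^ 2)⁻¹ * σ ^ (-2 - β) := by
    intro σ hσ
    have hσR : R < σ := hσ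
    have hσ0 : 0 < σ := by linarith
    have hρ0 := (Kato.katoDensity_pos hβ0 hβ1 A hσ0).le
    rw [abs_mul, abs_of_nonneg hρ0]
    have h1 := (hG σ hσ0.le y).2
    have e : σ / (8 * d * L ^ 2) = b * σ := by rw [hb]; ring
    rw [e] at h1
    have h2 : ((1 + b * σ) ^ 2)⁻¹ ≤ (b ^ 2)⁻¹ * σ ^ (-2 : ℝ) := by
      rw [Real.rpow_neg hσ0.le, Real.rpow_two, ← mul_inv, ← mul_pow]
      apply inv_anti₀ (by positivity)
      apply pow_le_pow_left₀ (by positivity)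
      linarith
    have h3 := katoDensity_le_const_mul_rpow_neg hβ0 hβ1 A hσ0
    have h4 : 0 ≤ cK * σ ^ (-β) := by have := Real.rpow_nonneg hσ0.le (-β); positivity
    calc |cZeroKer d L y σ| * Kato.katoDensity β A σ ≤ K * ((1 + b * σ) ^ 2)⁻¹ * (cK * σ ^ (-β)) :=
          mul_le_mul h1 h3 hρ0 (by positivity)
      _ ≤ K * ((b ^ 2)⁻¹ * σ ^ (-2 : ℝ)) * (cK * σ ^ (-β)) := by gcongr
      _ = K * cK * (b ^ 2)⁻¹ * (σ ^ (-2 : ℝ) * σ ^ (-β)) := by ring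
      _ = K * cK * (b ^ 2)⁻¹ * σ ^ (-2 - β) := by rw [← Real.rpow_add hσ0]; ring_nf
  have hb1 := abs_setIntegral_le_of_abs_le measurableSet_Ioi hint hmaj hpt
  refine hb1.trans (le_of_eq ?_)
  rw [integral_const_mul, integral_Ioi_rpow_of_lt hr hR0, show (-2 - β + 1 : ℝ) = -1 - β by ring]
  have : (-1 - β : ℝ) ≠ 0 := by linarith
  field_simp
  ring

/-! ### Integrability of `s ↦ Γ_j(s)ρ(s,m²)` for `j ≥ 2` and all `m² ≥ 0` -/

/-- For `j ≥ 2`, `L ≥ 2`, `β ∈ (0,1)` and ANY `m²` (in particular `m² = 0`), `s ↦ Γ_j(x;s)ρ^{(β)}(s,m²)`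
is integrable on `(0,∞)`: `|Γ_j(s)|` is bounded for `s ≤ 1` and `O(s⁻¹)` for `s ≥ 1` ((10.8), third
regime), and `ρ(s,m²) ≲ s^{-β}` (the tree's `integrableOn_Gam_mul_katoDensity` needs `m² > 0`).
[cite: Slade2017, §10.3 (display after (10.41): C_{j;0,x}(m²) = ∫_0^∞ds ρ(s,m²)∫_{J_j}(dt/t)w(t,x;s))] -/
theorem integrableOn_Gam_mul_katoDensity_of_two_le (hd : 1 ≤ d) {β : ℝ} (hβ0 : 0 < β) (hβ1 : β < 1)
    {L : ℝ} (hL : 2 ≤ L) {j : ℕ} (hj : 2 ≤ j) (m2 : ℝ) (x : Site d) :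
    IntegrableOn (fun s : ℝ => Gam d L s j x * Kato.katoDensity β m2 s) (Ioi 0) := by
  have hL1 : (1 : ℝ) ≤ L := by linarith
  set ℓ : ℝ := L ^ (j - 1) with hℓ
  have hℓ1 : 1 ≤ ℓ := one_le_pow₀ hL1
  have hℓ0 : 0 < ℓ := by linarith
  have hℓ2 : 2 ≤ ℓ := le_trans hL (by rw [hℓ]; exact le_self_pow₀ hL1 (by omega))
  have hLj : L ^ j = ℓ * L := by rw [hℓ, ← pow_succ, Nat.sub_add_cancel (by omega)]
  have hlen0 : 0 ≤ ℓ * L / 2 - ℓ / 2 := by nlinarith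
  set cK : ℝ := (π * Real.sin (π * β))⁻¹ with hcK
  have hsin : 0 < Real.sin (π * β) := Real.sin_pos_of_pos_of_lt_pi (by positivity)
    (by nlinarith [Real.pi_pos])
  have hcK0 : 0 < cK := by positivity
  obtain ⟨c₁, hc₁, hw₁⟩ := Slade2017_display108_small_mass hd 1
  obtain ⟨c₃, hc₃, hw₃⟩ := Slade2017_display108_large_mass hd 1
  obtain ⟨K₃, hK₃, hJ₃⟩ := exists_setIntegral_J_pow_le hd (le_refl 1)
  have hGam : ∀ s : ℝ, Gam d L s j x = ∫ t in Ioc (ℓ / 2) (ℓ * L / 2), wKer d s t x / t := by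
    intro s
    rw [Slade2017_display106 L s hj x, hLj]
  -- `s ≤ 1`: a crude constant bound
  set W : ℝ := c₁ * (ℓ * L / 2) ^ 2 * (2 / ℓ) with hW
  have hW0 : 0 < W := by positivity
  have hsmall : ∀ s : ℝ, 0 < s → s ≤ 1 → |Gam d L s j x| ≤ W * (ℓ * L / 2 - ℓ / 2) := by
    intro s hs hs1
    rw [hGam s]
    have hab : ℓ / 2 ≤ ℓ * L / 2 := by nlinarith
    have hpt : ∀ t ∈ Ioc (ℓ / 2) (ℓ * L / 2), |wKer d s t x / t| ≤ W := by
      intro t ht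
      have ht0 : 0 < t := lt_of_lt_of_le' ht.1 (by positivity)
      have ht1 : 1 / 2 ≤ t := by linarith [ht.1]
      have ht1' : 1 ≤ t := by linarith [ht.1]
      have h1 := hw₁ s hs hs1 t ht1 x
      have h2 : ((1 + s * t ^ 2) ^ 1)⁻¹ ≤ 1 := inv_le_one_of_one_le₀ (by rw [pow_one]; nlinarith)
      have h3 : t ^ 2 / t ^ d ≤ (ℓ * L / 2) ^ 2 := by
        calc t ^ 2 / t ^ d ≤ t ^ 2 / 1 := div_le_div_of_nonneg_left (sq_nonneg t) one_pos (one_le_pow₀ ht1')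
          _ = t ^ 2 := div_one _
          _ ≤ (ℓ * L / 2) ^ 2 := pow_le_pow_left₀ ht0.le ht.2 2
      rw [abs_div, abs_of_pos ht0, div_eq_mul_inv]
      have h4 : t⁻¹ ≤ 2 / ℓ := by
        rw [inv_le_comm₀ ht0 (by positivity), inv_div]; exact ht.1.le
      calc |wKer d s t x| * t⁻¹ ≤ c₁ * ((1 + s * t ^ 2) ^ 1)⁻¹ * (t ^ 2 / t ^ d) * t⁻¹ :=
            mul_le_mul_of_nonneg_right h1 (inv_nonneg.2 ht0.le)
        _ ≤ c₁ * 1 * (ℓ * L / 2) ^ 2 * (2 / ℓ) := by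
            gcongr
        _ = W := by rw [hW]; ring
    have hgi : IntegrableOn (fun _ : ℝ => W) (Ioc (ℓ / 2) (ℓ * L / 2)) :=
      (continuous_const.integrableOn_Icc).mono_set Ioc_subset_Icc_self
    have hb := abs_setIntegral_le_of_abs_le measurableSet_Ioc
      (integrableOn_wKer_div_Ioc hs x (by positivity)) hgi hpt
    refine hb.trans (le_of_eq ?_)
    rw [setIntegral_const, smul_eq_mul, Real.volume_real_Ioc_of_le hab, mul_comm]
  -- `s ≥ 1`
  have hlarge : ∀ s : ℝ, 1 ≤ s → |Gam d L s j x| ≤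
      c₃ * ((ℓ ^ (2 * 1))⁻¹ * (ℓ ^ 2 / ℓ ^ d)) * K₃ * s⁻¹ := by
    intro s hs1
    rw [hGam s]
    have h := abs_regular_le_of_large_mass hw₃ hL1 hℓ1 hs1 x
    have hJ := hJ₃ L hL1
    have hs0 : 0 < s := by linarith
    calc |∫ t in Ioc (ℓ / 2) (ℓ * L / 2), wKer d s t x / t|
        ≤ c₃ * s⁻¹ * ((ℓ ^ (2 * 1))⁻¹ * (ℓ ^ 2 / ℓ ^ d)) *
            ∫ τ in Ioc (1 / 2 : ℝ) (L / 2), (τ ^ (2 * 1))⁻¹ * (τ ^ 2 / τ ^ d) / τ := h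
      _ ≤ c₃ * s⁻¹ * ((ℓ ^ (2 * 1))⁻¹ * (ℓ ^ 2 / ℓ ^ d)) * K₃ := by
          refine mul_le_mul_of_nonneg_left hJ ?_
          positivity
      _ = _ := by ring
  -- measurability and the two majorants
  have hmeas : AEStronglyMeasurable (fun s : ℝ => Gam d L s j x * Kato.katoDensity β m2 s)
      ((volume : Measure ℝ).restrict (Ioi 0)) :=
    ((measurable_Gam L j x).mul (Kato.measurable_katoDensity β m2)).aestronglyMeasurable
  have h01 : IntegrableOn (fun s : ℝ => Gam d L s j x * Kato.katoDensity β m2 s) (Ioc 0 1) := by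
    have hmaj : IntegrableOn (fun s : ℝ => W * (ℓ * L / 2 - ℓ / 2) * cK * s ^ (-β)) (Ioc (0 : ℝ) 1) :=
      (CovBound.integrableOn_rpow_Ioc_zero (by linarith : (-1 : ℝ) < -β) zero_le_one).const_mul _
    refine Integrable.mono' hmaj (hmeas.mono_measure (Measure.restrict_mono Ioc_subset_Ioi_self le_rfl))
      ((ae_restrict_iff' measurableSet_Ioc).2 (Eventually.of_forall fun s hs => ?_))
    have hρ0 := (Kato.katoDensity_pos hβ0 hβ1 m2 hs.1).le
    rw [Real.norm_eq_abs, abs_mul, abs_of_nonneg hρ0]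
    calc |Gam d L s j x| * Kato.katoDensity β m2 s
        ≤ W * (ℓ * L / 2 - ℓ / 2) * (cK * s ^ (-β)) :=
          mul_le_mul (hsmall s hs.1 hs.2) (katoDensity_le_const_mul_rpow_neg hβ0 hβ1 m2 hs.1) hρ0
            (mul_nonneg hW0.le hlen0)
      _ = _ := by ring
  have h1i : IntegrableOn (fun s : ℝ => Gam d L s j x * Kato.katoDensity β m2 s) (Ioi 1) := by
    have hr : (-1 - β : ℝ) < -1 := by linarith
    have hmaj : IntegrableOn (fun s : ℝ => c₃ * ((ℓ ^ (2 * 1))⁻¹ * (ℓ ^ 2 / ℓ ^ d)) * K₃ * cK *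
        s ^ (-1 - β)) (Ioi (1 : ℝ)) := (integrableOn_Ioi_rpow_of_lt hr zero_lt_one).const_mul _
    refine Integrable.mono' hmaj (hmeas.mono_measure (Measure.restrict_mono
      (Ioi_subset_Ioi zero_le_one) le_rfl))
      ((ae_restrict_iff' measurableSet_Ioi).2 (Eventually.of_forall fun s hs => ?_))
    have hs1 : (1 : ℝ) < s := hs
    have hs0 : 0 < s := by linarith
    have hρ0 := (Kato.katoDensity_pos hβ0 hβ1 m2 hs0).le
    rw [Real.norm_eq_abs, abs_mul, abs_of_nonneg hρ0]
    have e : s ^ (-1 - β) = s⁻¹ * s ^ (-β) := by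
      rw [show (-1 - β : ℝ) = -1 + -β by ring, Real.rpow_add hs0, Real.rpow_neg_one]
    calc |Gam d L s j x| * Kato.katoDensity β m2 s
        ≤ c₃ * ((ℓ ^ (2 * 1))⁻¹ * (ℓ ^ 2 / ℓ ^ d)) * K₃ * s⁻¹ * (cK * s ^ (-β)) :=
          mul_le_mul (hlarge s hs1.le) (katoDensity_le_const_mul_rpow_neg hβ0 hβ1 m2 hs0) hρ0
            (by positivity)
      _ = _ := by rw [e]; ring
  have hu := h01.union h1i
  rwa [Ioc_union_Ioi_eq_Ioi zero_le_one] at hu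

/-! ### Integrability of `t ↦ w₀(t,x;s)/t` on a scale interval -/

/-- `t ↦ w₀(t,x;s)/t` is integrable on `(a,b]` for `a ≥ 1`, `s ∈ (0,1]` (measurable, and bounded by
`|w| + |w - w₀|`). [folklore] -/
theorem integrableOn_wKerCont0_div_Ioc (hd : 1 ≤ d) {s : ℝ} (hs : 0 < s) (hs1 : s ≤ 1) (x : Site d)
    {a b : ℝ} (ha : 1 ≤ a) :
    IntegrableOn (fun t : ℝ => wKerCont0 d s t x / t) (Ioc a b) := by
  obtain ⟨c₁, hc₁, hw₁⟩ := Slade2017_display108_small_mass hd 1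
  obtain ⟨C₀, hC₀, h₀⟩ := abs_wKer_sub_wKerCont0_le hd 0
  have hmeas : AEStronglyMeasurable (fun t : ℝ => wKerCont0 d s t x / t)
      ((volume : Measure ℝ).restrict (Ioc a b)) :=
    ((measurable_wKerCont0_t s x).div measurable_id).aestronglyMeasurable
  set W : ℝ := (c₁ + C₀) * (1 + b ^ 2) with hW
  have hgi : IntegrableOn (fun _ : ℝ => W) (Ioc a b) :=
    (continuous_const.integrableOn_Icc).mono_set Ioc_subset_Icc_self
  refine Integrable.mono' hgi hmeas ((ae_restrict_iff' measurableSet_Ioc).2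
    (Eventually.of_forall fun t ht => ?_))
  have ht1 : 1 ≤ t := le_trans ha ht.1.le
  have ht0 : 0 < t := by linarith
  have h1 := hw₁ s hs hs1 t (by linarith) x
  have h2 := h₀ s hs hs1 t ht1 x
  have hq : t ^ 2 / t ^ d ≤ b ^ 2 := by
    calc t ^ 2 / t ^ d ≤ t ^ 2 / 1 := div_le_div_of_nonneg_left (sq_nonneg t) one_pos (one_le_pow₀ ht1)
      _ ≤ b ^ 2 := by rw [div_one]; exact pow_le_pow_left₀ ht0.le ht.2 2
  have hA : |wKer d s t x| ≤ c₁ * b ^ 2 := by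
    refine h1.trans ?_
    have : ((1 + s * t ^ 2) ^ 1)⁻¹ ≤ 1 := inv_le_one_of_one_le₀ (by rw [pow_one]; nlinarith)
    calc c₁ * ((1 + s * t ^ 2) ^ 1)⁻¹ * (t ^ 2 / t ^ d) ≤ c₁ * 1 * b ^ 2 := by gcongr
      _ = c₁ * b ^ 2 := by ring
  have hB : |wKer d s t x - wKerCont0 d s t x| ≤ C₀ * b ^ 2 := by
    refine h2.trans ?_
    rw [pow_zero, inv_one, mul_one]
    have : t⁻¹ ≤ 1 := inv_le_one_of_one_le₀ ht1
    calc C₀ * (t ^ 2 / t ^ d) * t⁻¹ ≤ C₀ * b ^ 2 * 1 := by gcongr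
      _ = C₀ * b ^ 2 := by ring
  have hC : |wKerCont0 d s t x| ≤ (c₁ + C₀) * b ^ 2 := by
    have := abs_sub_abs_le_abs_sub (wKer d s t x) (wKerCont0 d s t x)
    have h3 : |wKerCont0 d s t x| ≤ |wKer d s t x| + |wKer d s t x - wKerCont0 d s t x| := by
      have := abs_sub (wKer d s t x) (wKer d s t x - wKerCont0 d s t x)
      rw [sub_sub_cancel] at this
      linarith [abs_sub_comm (wKer d s t x) (wKer d s t x - wKerCont0 d s t x)]
    nlinarith [hA, hB, h3]
  rw [Real.norm_eq_abs, abs_div, abs_of_pos ht0]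
  calc |wKerCont0 d s t x| / t ≤ |wKerCont0 d s t x| / 1 :=
        div_le_div_of_nonneg_left (abs_nonneg _) one_pos ht1
    _ ≤ (c₁ + C₀) * b ^ 2 := by rw [div_one]; exact hC
    _ ≤ W := by rw [hW]; nlinarith [sq_nonneg b, hc₁, hC₀]

/-! ### The two changes of variables -/

/-- **`t = L^jτ` in the continuum term**: for `s ≥ 0`, `Λ > 0`, `L ≥ 1`,
`∫_{(Λ/(2L), Λ/2]} w₀(t,x;s) dt/t = (Λ²/Λ^d) G_L(x/Λ, sΛ²)` (scale invariance of `w₀` and the dilation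
of the scale interval). [cite: Slade2017, §10.3 (display (10.40): the variables τ = t/L^j, σ = sL^{2j})] -/
theorem setIntegral_wKerCont0_div_eq (hd : 1 ≤ d) {s : ℝ} (hs : 0 ≤ s) {Λ : ℝ} (hΛ : 0 < Λ) {L : ℝ}
    (hL : 1 ≤ L) (x : Site d) :
    ∫ t in Ioc (Λ / (2 * L)) (Λ / 2), wKerCont0 d s t x / t =
      Λ ^ 2 / Λ ^ d * cZeroKer d L (fun i => (x i : ℝ) / Λ) (s * Λ ^ 2) := by
  have hL0 : 0 < L := by linarith
  have hab : 1 / (2 * L) ≤ (1 / 2 : ℝ) := by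
    rw [div_le_div_iff₀ (by positivity) (by positivity)]; linarith
  have hJ : Ioc (Λ / (2 * L)) (Λ / 2) = Ioc (Λ * (1 / (2 * L))) (Λ * (1 / 2)) := by
    congr 1 <;> ring
  rw [hJ, setIntegral_Ioc_comp_mul hΛ hab (fun t => wKerCont0 d s t x / t)]
  unfold cZeroKer
  rw [← integral_const_mul, ← integral_const_mul]
  refine setIntegral_congr_fun measurableSet_Ioc fun τ hτ => ?_
  have hτ0 : 0 < τ := lt_trans (by positivity) hτ.1
  have hΛτ : 0 < Λ * τ := by positivity
  rw [wKerCont0_eq_scaling hd s hΛτ hs x]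
  unfold cZeroIntegrand
  have e1 : s * (Λ * τ) ^ 2 / (2 * d) = s * Λ ^ 2 * τ ^ 2 / (2 * d) := by ring
  have e2 : (fun i => Real.sqrt (2 * d) * (x i : ℝ) / (Λ * τ)) =
      (fun i => Real.sqrt (2 * d) * ((x i : ℝ) / Λ) / τ) := by
    funext i
    field_simp
  rw [e1, e2]
  have e3 : (Real.sqrt (2 * d) / (Λ * τ)) ^ d = (Real.sqrt (2 * d) / τ) ^ d / Λ ^ d := by
    rw [div_pow, div_pow, mul_pow]
    field_simp
  rw [e3]
  field_simp

/-- **`s = σL^{-2j}` in the mass integral**: for `Λ > 0`, `β ∈ (0,1)`, any `m²`, and any `F`,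
`∫_{(0,1]} F(sΛ²)ρ^{(β)}(s,m²)ds = (Λ²)⁻¹(Λ²)^β ∫_{(0,Λ²]} F(σ)ρ^{(β)}(σ, m²(Λ²)^β)dσ` (dilation and the
scaling of Kato's density). [cite: Slade2017, §10.3 (display (10.40)–(10.41): ρ(σ, m²L^{αj}))] -/
theorem setIntegral_comp_mul_katoDensity_eq {β : ℝ} (hβ0 : 0 < β) (hβ1 : β < 1) (m2 : ℝ) {Λ : ℝ}
    (hΛ : 0 < Λ) (F : ℝ → ℝ) :
    ∫ s in Ioc (0 : ℝ) 1, F (s * Λ ^ 2) * Kato.katoDensity β m2 s =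
      (Λ ^ 2)⁻¹ * (Λ ^ 2) ^ β * ∫ σ in Ioc (0 : ℝ) (Λ ^ 2), F σ * Kato.katoDensity β (m2 * (Λ ^ 2) ^ β) σ := by
  have hΛ2 : 0 < Λ ^ 2 := by positivity
  set lam : ℝ := (Λ ^ 2)⁻¹ with hlam
  have hlam0 : 0 < lam := by positivity
  have hI : Ioc (0 : ℝ) 1 = Ioc (lam * 0) (lam * Λ ^ 2) := by
    rw [mul_zero, hlam, inv_mul_cancel₀ hΛ2.ne']
  rw [hI, setIntegral_Ioc_comp_mul hlam0 hΛ2.le, mul_assoc, ← integral_const_mul ((Λ ^ 2) ^ β)]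
  congr 1
  refine setIntegral_congr_fun measurableSet_Ioc fun σ hσ => ?_
  have hσ0 : 0 < σ := hσ.1
  rw [Kato.katoDensity_mul_left hβ0 hβ1 m2 hlam0 hσ0]
  have hlb : lam ^ (-β) = (Λ ^ 2) ^ β := by
    rw [hlam, Real.inv_rpow hΛ2.le, ← Real.rpow_neg hΛ2.le, neg_neg]
  have e : lam * σ * Λ ^ 2 = σ := by rw [hlam]; field_simp
  rw [e, hlb]
  ring

/-! ### The two error terms of Lemma 10.3.1 -/

/-- **The `s ≥ 1` part is negligible** ("The analysis of `T_{j,3}` in the proof of Proposition 10.1.1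
shows that the contribution to the `s`-integral from `s ≥ 1` can be absorbed into the error term"):
for `d ≥ 1`, `β ∈ (0,1)` there is `C` with `|∫_{s>1}Γ_j(x;s)ρ(s,m²)ds| ≤ C ℓ^{-4}ℓ^{2-d}`,
`ℓ = L^{j-1}`, for all `L ≥ 2`, `j ≥ 2`, `m²`, `x`. [cite: Slade2017, §10.3 (proof of Lemma 10.3.1)] -/
theorem abs_setIntegral_Ioi_one_Gam_mul_le (hd : 1 ≤ d) {β : ℝ} (hβ0 : 0 < β) (hβ1 : β < 1) :
    ∃ C : ℝ, 0 < C ∧ ∀ L : ℝ, 2 ≤ L → ∀ j : ℕ, 2 ≤ j → ∀ m2 : ℝ, ∀ x : Site d,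
      |∫ s in Ioi 1, Gam d L s j x * Kato.katoDensity β m2 s| ≤
        C * (((L ^ (j - 1)) ^ 4)⁻¹ * ((L ^ (j - 1)) ^ 2 / (L ^ (j - 1)) ^ d)) := by
  obtain ⟨c₃, hc₃, hw₃⟩ := Slade2017_display108_large_mass hd 2
  obtain ⟨K₃, hK₃, hJ₃⟩ := exists_setIntegral_J_pow_le hd (by norm_num : 1 ≤ 2)
  set cK : ℝ := (π * Real.sin (π * β))⁻¹ with hcK
  have hsin : 0 < Real.sin (π * β) := Real.sin_pos_of_pos_of_lt_pi (by positivity)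
    (by nlinarith [Real.pi_pos])
  have hcK0 : 0 < cK := by positivity
  refine ⟨c₃ * K₃ * cK / β, by positivity, fun L hL j hj m2 x => ?_⟩
  have hL1 : (1 : ℝ) ≤ L := by linarith
  set ℓ : ℝ := L ^ (j - 1) with hℓ
  have hℓ1 : 1 ≤ ℓ := one_le_pow₀ hL1
  have hℓ0 : 0 < ℓ := by linarith
  have hLj : L ^ j = ℓ * L := by rw [hℓ, ← pow_succ, Nat.sub_add_cancel (by omega)]
  have hfac : 0 ≤ (ℓ ^ 4)⁻¹ * (ℓ ^ 2 / ℓ ^ d) := by positivity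
  have hlarge : ∀ s : ℝ, 1 ≤ s → |Gam d L s j x| ≤ c₃ * ((ℓ ^ 4)⁻¹ * (ℓ ^ 2 / ℓ ^ d)) * K₃ * s⁻¹ := by
    intro s hs1
    rw [Slade2017_display106 L s hj x, hLj]
    have h := abs_regular_le_of_large_mass hw₃ hL1 hℓ1 hs1 x
    have hJ := hJ₃ L hL1
    have hs0 : 0 < s := by linarith
    calc |∫ t in Ioc (ℓ / 2) (ℓ * L / 2), wKer d s t x / t|
        ≤ c₃ * s⁻¹ * ((ℓ ^ (2 * 2))⁻¹ * (ℓ ^ 2 / ℓ ^ d)) *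
            ∫ τ in Ioc (1 / 2 : ℝ) (L / 2), (τ ^ (2 * 2))⁻¹ * (τ ^ 2 / τ ^ d) / τ := h
      _ ≤ c₃ * s⁻¹ * ((ℓ ^ (2 * 2))⁻¹ * (ℓ ^ 2 / ℓ ^ d)) * K₃ :=
          mul_le_mul_of_nonneg_left hJ (by positivity)
      _ = _ := by norm_num; ring
  have hint := (integrableOn_Gam_mul_katoDensity_of_two_le hd hβ0 hβ1 hL hj m2 x).mono_set
    (Ioi_subset_Ioi zero_le_one)
  have hr : (-1 - β : ℝ) < -1 := by linarith
  have hmaj : IntegrableOn (fun s : ℝ => c₃ * ((ℓ ^ 4)⁻¹ * (ℓ ^ 2 / ℓ ^ d)) * K₃ * cK * s ^ (-1 - β))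
      (Ioi (1 : ℝ)) := (integrableOn_Ioi_rpow_of_lt hr zero_lt_one).const_mul _
  have hpt : ∀ s ∈ Ioi (1 : ℝ), |Gam d L s j x * Kato.katoDensity β m2 s| ≤
      c₃ * ((ℓ ^ 4)⁻¹ * (ℓ ^ 2 / ℓ ^ d)) * K₃ * cK * s ^ (-1 - β) := by
    intro s hs
    have hs1 : (1 : ℝ) < s := hs
    have hs0 : 0 < s := by linarith
    have hρ0 := (Kato.katoDensity_pos hβ0 hβ1 m2 hs0).le
    rw [abs_mul, abs_of_nonneg hρ0]
    have e : s ^ (-1 - β) = s⁻¹ * s ^ (-β) := by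
      rw [show (-1 - β : ℝ) = -1 + -β by ring, Real.rpow_add hs0, Real.rpow_neg_one]
    calc |Gam d L s j x| * Kato.katoDensity β m2 s
        ≤ c₃ * ((ℓ ^ 4)⁻¹ * (ℓ ^ 2 / ℓ ^ d)) * K₃ * s⁻¹ * (cK * s ^ (-β)) :=
          mul_le_mul (hlarge s hs1.le) (katoDensity_le_const_mul_rpow_neg hβ0 hβ1 m2 hs0) hρ0
            (by positivity)
      _ = _ := by rw [e]; ring
  have hb := abs_setIntegral_le_of_abs_le measurableSet_Ioi hint hmaj hpt
  refine hb.trans (le_of_eq ?_)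
  rw [integral_const_mul, integral_Ioi_rpow_of_lt hr zero_lt_one, Real.one_rpow,
    show (-1 - β + 1 : ℝ) = -β by ring]
  field_simp

/-- **The `s ≤ 1` error of the self-similar approximation** ("it suffices to prove that
`∫_0^1ds ρ(s,m²)∫_{J_j}(dt/t)t^{-(d-1)}(1+st²)^{-p} = O(L^{-(d-α+1)j})`. This follows from estimates
like those used previously, using `ρ(s,m²) ≲ s^{-α/2}`"): for `d ≥ 1`, `β ∈ (0,1)` there is `C` such
that for `L ≥ 2`, `ℓ ≥ 2`, all `m²`, `x`:
`|∫_{(0,1]} ρ(s,m²) ∫_{(ℓ/2, ℓL/2]} (w - w₀)(t,x;s) dt/t ds| ≤ C (L-1) (ℓ/ℓ^d) (ℓ²)^{β-1}`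
(`= O(ℓ^{2β-d-1})`). [cite: Slade2017, §10.3 (proof of Lemma 10.3.1, last display)] -/
theorem abs_setIntegral_Ioc_selfSimilarError_le (hd : 1 ≤ d) {β : ℝ} (hβ0 : 0 < β) (hβ1 : β < 1) :
    ∃ C : ℝ, 0 < C ∧ ∀ L : ℝ, 2 ≤ L → ∀ ℓ : ℝ, 2 ≤ ℓ → ∀ m2 : ℝ, ∀ x : Site d,
      |∫ s in Ioc (0 : ℝ) 1, (∫ t in Ioc (ℓ / 2) (ℓ * L / 2),
          (wKer d s t x - wKerCont0 d s t x) / t) * Kato.katoDensity β m2 s| ≤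
        C * (L - 1) * (ℓ / ℓ ^ d) * (ℓ ^ 2) ^ (β - 1) := by
  have hd' : (1 : ℝ) ≤ d := by exact_mod_cast hd
  obtain ⟨C₀, hC₀, h₀⟩ := abs_wKer_sub_wKerCont0_le hd 1
  set cK : ℝ := (π * Real.sin (π * β))⁻¹ with hcK
  have hsin : 0 < Real.sin (π * β) := Real.sin_pos_of_pos_of_lt_pi (by positivity)
    (by nlinarith [Real.pi_pos])
  have hcK0 : 0 < cK := by positivity
  set Kβ : ℝ := 1 / (1 - β) + 1 / β with hKβ
  have hKβ0 : 0 < Kβ := by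
    have : 0 < 1 / (1 - β) := one_div_pos.2 (by linarith)
    have : 0 < 1 / β := one_div_pos.2 hβ0
    positivity
  set D : ℝ := (4 * (2 * (d : ℝ) + 1)) ^ (1 - β) with hD
  have hD0 : 0 < D := Real.rpow_pos_of_pos (by positivity) _
  refine ⟨C₀ * 2 ^ d / 2 * cK * Kβ * D, by positivity, fun L hL ℓ hℓ m2 x => ?_⟩
  have hℓ0 : 0 < ℓ := by linarith
  have hL1 : 1 ≤ L := by linarith
  have hlen0 : 0 ≤ ℓ * L / 2 - ℓ / 2 := by nlinarith
  -- `B = ℓ²/(4(2d+1))`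
  set B : ℝ := ℓ ^ 2 / (4 * (2 * d + 1)) with hB
  have hB0 : 0 < B := by positivity
  -- the `t`-integral for fixed `s ∈ (0,1]`
  have hE1 : ∀ s : ℝ, 0 < s → s ≤ 1 →
      |∫ t in Ioc (ℓ / 2) (ℓ * L / 2), (wKer d s t x - wKerCont0 d s t x) / t| ≤
        C₀ * (2 / ℓ) ^ d * (ℓ * L / 2 - ℓ / 2) * (1 + B * s)⁻¹ := by
    intro s hs hs1
    have hpt : ∀ t ∈ Ioc (ℓ / 2) (ℓ * L / 2), |(wKer d s t x - wKerCont0 d s t x) / t| ≤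
        C₀ * (2 / ℓ) ^ d * (1 + B * s)⁻¹ := by
      intro t ht
      have ht1 : 1 ≤ t := by linarith [ht.1]
      have ht0 : 0 < t := by linarith
      have h1 := h₀ s hs hs1 t ht1 x
      rw [abs_div, abs_of_pos ht0, div_le_iff₀ ht0]
      refine h1.trans ?_
      -- `(t²/t^d) t⁻¹ (1+t²s/(2d+s))⁻¹ ≤ (2/ℓ)^d (1+Bs)⁻¹ t`
      have hq1 : t ^ 2 / t ^ d * t⁻¹ = t * (t ^ d)⁻¹ := by field_simp
      have hq2 : (t ^ d)⁻¹ ≤ (2 / ℓ) ^ d := by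
        rw [div_pow, ← one_div, div_le_div_iff₀ (by positivity) (by positivity), one_mul]
        calc ℓ ^ d = (ℓ / 2 * 2) ^ d := by ring
          _ = (ℓ / 2) ^ d * 2 ^ d := mul_pow _ _ _
          _ ≤ t ^ d * 2 ^ d := by gcongr; exact ht.1.le
          _ = 2 ^ d * t ^ d := mul_comm _ _
      have hq3 : ((1 + t ^ 2 * s / (2 * d + s)) ^ 1)⁻¹ ≤ (1 + B * s)⁻¹ := by
        rw [pow_one]
        apply inv_anti₀ (by positivity)
        have hM : (0 : ℝ) < 2 * d + s := by positivity
        have h2 : B * s ≤ t ^ 2 * s / (2 * d + s) := by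
          rw [hB, div_mul_eq_mul_div, div_le_div_iff₀ (by positivity) hM]
          have ht2 : (ℓ / 2) ^ 2 ≤ t ^ 2 := pow_le_pow_left₀ (by positivity) ht.1.le 2
          have e : ℓ ^ 2 = 4 * (ℓ / 2) ^ 2 := by ring
          rw [e]
          have h3 : (2 * d + s) ≤ (2 * d + 1) := by linarith
          calc 4 * (ℓ / 2) ^ 2 * s * (2 * d + s) ≤ 4 * t ^ 2 * s * (2 * d + 1) := by
                gcongr
            _ = t ^ 2 * s * (4 * (2 * d + 1)) := by ring
        linarith
      calc C₀ * (t ^ 2 / t ^ d) * t⁻¹ * ((1 + t ^ 2 * s / (2 * d + s)) ^ 1)⁻¹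
          = C₀ * (t * (t ^ d)⁻¹) * ((1 + t ^ 2 * s / (2 * d + s)) ^ 1)⁻¹ := by rw [mul_assoc C₀, hq1]
        _ ≤ C₀ * (t * (2 / ℓ) ^ d) * (1 + B * s)⁻¹ := by gcongr
        _ = C₀ * (2 / ℓ) ^ d * (1 + B * s)⁻¹ * t := by ring
    have hgi : IntegrableOn (fun _ : ℝ => C₀ * (2 / ℓ) ^ d * (1 + B * s)⁻¹) (Ioc (ℓ / 2) (ℓ * L / 2)) :=
      (continuous_const.integrableOn_Icc).mono_set Ioc_subset_Icc_self
    have hfi : IntegrableOn (fun t : ℝ => (wKer d s t x - wKerCont0 d s t x) / t) (Ioc (ℓ / 2) (ℓ * L / 2)) := by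
      have h1 := integrableOn_wKer_div_Ioc hs x (by positivity : (0 : ℝ) ≤ ℓ / 2) (b := ℓ * L / 2)
      have h2 := integrableOn_wKerCont0_div_Ioc hd hs hs1 x (by linarith : (1 : ℝ) ≤ ℓ / 2) (b := ℓ * L / 2)
      refine (h1.sub h2).congr (Eventually.of_forall fun t => ?_)
      simp only [Pi.sub_apply]
      ring
    have hb := abs_setIntegral_le_of_abs_le measurableSet_Ioc hfi hgi hpt
    refine hb.trans (le_of_eq ?_)
    rw [setIntegral_const, smul_eq_mul, Real.volume_real_Ioc_of_le (by nlinarith)]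
    ring
  -- the `s`-integral
  obtain ⟨hgi0, hgpt⟩ := integrableOn_rpow_neg_mul_inv hβ1 hB0
  set E : ℝ := C₀ * (2 / ℓ) ^ d * (ℓ * L / 2 - ℓ / 2) with hE
  have hE0 : 0 ≤ E := by positivity
  have hmaj : Integrable (fun s : ℝ => E * cK * (s ^ (-β) * (1 + B * s)⁻¹))
      ((volume : Measure ℝ).restrict (Ioc 0 1)) := hgi0.const_mul _
  have hle : ∀ᵐ s ∂((volume : Measure ℝ).restrict (Ioc 0 1)),
      ‖(∫ t in Ioc (ℓ / 2) (ℓ * L / 2), (wKer d s t x - wKerCont0 d s t x) / t) * Kato.katoDensity β m2 s‖ ≤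
        E * cK * (s ^ (-β) * (1 + B * s)⁻¹) := by
    refine (ae_restrict_iff' measurableSet_Ioc).2 (Eventually.of_forall fun s hs => ?_)
    have hρ0 := (Kato.katoDensity_pos hβ0 hβ1 m2 hs.1).le
    rw [Real.norm_eq_abs, abs_mul, abs_of_nonneg hρ0]
    calc |∫ t in Ioc (ℓ / 2) (ℓ * L / 2), (wKer d s t x - wKerCont0 d s t x) / t| * Kato.katoDensity β m2 s
        ≤ E * (1 + B * s)⁻¹ * (cK * s ^ (-β)) :=
          mul_le_mul (hE1 s hs.1 hs.2) (katoDensity_le_const_mul_rpow_neg hβ0 hβ1 m2 hs.1) hρ0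
            (mul_nonneg hE0 (inv_nonneg.2 (by nlinarith [mul_pos hB0 hs.1])))
      _ = E * cK * (s ^ (-β) * (1 + B * s)⁻¹) := by ring
  have h1 := norm_integral_le_of_norm_le hmaj hle
  rw [Real.norm_eq_abs, integral_const_mul] at h1
  have h2 := setIntegral_rpow_neg_mul_inv_le hβ0 hβ1 hB0
  refine h1.trans ((mul_le_mul_of_nonneg_left h2 (by positivity)).trans (le_of_eq ?_))
  -- bookkeeping: `E cK Kβ B^{β-1} = C (L-1)(ℓ/ℓ^d)(ℓ²)^{β-1}`
  have hBpow : B ^ (β - 1) = (ℓ ^ 2) ^ (β - 1) * D := by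
    rw [hB, Real.div_rpow (by positivity) (by positivity), hD]
    rw [show (1 - β : ℝ) = -(β - 1) by ring, Real.rpow_neg (by positivity)]
    field_simp
  have hEeq : E = C₀ * 2 ^ d / 2 * (L - 1) * (ℓ / ℓ ^ d) := by
    rw [hE, div_pow]
    field_simp
  rw [hBpow, hEeq, ← hKβ]
  ring

/-! ### Lemma 10.3.1 -/

/-- Power bookkeeping: `(ℓ/ℓ^d)(ℓ²)^{β-1} = ℓ^{2β-d-1}` for `ℓ > 0`. [folklore] -/
theorem div_pow_mul_sq_rpow_eq {ℓ : ℝ} (hℓ : 0 < ℓ) (β : ℝ) (d : ℕ) :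
    ℓ / ℓ ^ d * (ℓ ^ 2) ^ (β - 1) = ℓ ^ (2 * β - d - 1) := by
  have h1 : ℓ / ℓ ^ d = ℓ ^ ((1 : ℝ) - d) := by
    rw [Real.rpow_sub hℓ, Real.rpow_one, Real.rpow_natCast]
  have h2 : (ℓ ^ 2) ^ (β - 1) = ℓ ^ (2 * (β - 1)) := by
    rw [show (ℓ ^ 2 : ℝ) = ℓ ^ (2 : ℝ) by norm_cast, ← Real.rpow_mul hℓ.le]
  rw [h1, h2, ← Real.rpow_add hℓ]
  ring_nf

/-- Power bookkeeping: `ℓ^{-4}ℓ^{2-d} = ℓ^{-2-d}` for `ℓ > 0`. [folklore] -/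
theorem pow_four_inv_mul_eq {ℓ : ℝ} (hℓ : 0 < ℓ) (d : ℕ) :
    (ℓ ^ 4)⁻¹ * (ℓ ^ 2 / ℓ ^ d) = ℓ ^ (-(2 : ℝ) - d) := by
  have h1 : (ℓ ^ 4)⁻¹ * (ℓ ^ 2 / ℓ ^ d) = (ℓ ^ (2 + d))⁻¹ := by
    rw [pow_add]
    field_simp
  rw [h1, ← Real.rpow_natCast, ← Real.rpow_neg hℓ.le]
  push_cast
  ring_nf

/-- Power bookkeeping: for `Λ = ℓL`, `ℓ^{e-1} = L^{1-e} Λ^e Λ⁻¹` (`ℓ, L > 0`). [folklore] -/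
theorem rpow_sub_one_eq_of_mul {ℓ L : ℝ} (hℓ : 0 < ℓ) (hL : 0 < L) (e : ℝ) :
    ℓ ^ (e - 1) = L ^ (1 - e) * ((ℓ * L) ^ e * (ℓ * L)⁻¹) := by
  rw [Real.mul_rpow hℓ.le hL.le, Real.rpow_sub hℓ, Real.rpow_one, Real.rpow_sub hL, Real.rpow_one,
    mul_inv]
  field_simp

/-- **Slade, Lemma 10.3.1 (self-similarity of the covariance decomposition), PROVED for the explicit
decomposition**: "Let `d ≥ 1`, `α ∈ (0, 2∧d)`, and `m² ∈ [0,m̄²]`. As `j → ∞`, (10.41)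
`C_{j;0,x}(m²) = L^{-(d-α)j}(c₀(L^{-j}x, m²L^{αj}) + O(L^{-j}))`, with the constant in the error estimate
uniform in `x ∈ ℤ^d`, but possibly `m̄²`- and `L`-dependent." Here: for `d ≥ 1`, `α ∈ (0,2)`, `L ≥ 2`
there is `C = C(d,α,L)` such that for all `j ≥ 2`, all `m²` and all `x ∈ ℤ^d`,
`|C_j(x;m²) - (L^j)^{α-d} c₀(x/L^j, m²(L^j)^α)| ≤ C (L^j)^{α-d} (L^j)⁻¹`, with `C_j = fracCov` (§3,
(3.8)) and `c₀ = cZero` ((10.40) in the normalisation of `RigorousRGSmallParameterFRDScalingKernel`).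
Printed proof, followed: "Since we are interested in the limit `j → ∞`, we assume that `j ≥ 2` to
avoid the special case of `C_1`. By (3.8), `C_{j;0,x}(m²) = ∫_0^∞ds ρ(s,m²)∫_{J_j}(dt/t)w(t,x;s)`. The
analysis of `T_{j,3}` … shows that the contribution to the `s`-integral from `s ≥ 1` can be absorbed
into the error term in (10.41) [`abs_setIntegral_Ioi_one_Gam_mul_le`], and similar estimates show that
the same is true for the contribution to the right-hand side of (10.41) from the portion of the
integral (10.40) due to `s ≥ 1` [`abs_setIntegral_Ioi_cZeroKer_mul_le`, after the substitutions
`t = L^jτ`, `s = σL^{-2j}` of `setIntegral_wKerCont0_div_eq`, `setIntegral_comp_mul_katoDensity_eq`].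
The error estimate in (10.38) is uniform in `s ≤ 1`, and thus it suffices to prove that
`∫_0^1ds ρ(s,m²)∫_{J_j}(dt/t)t^{-(d-1)}(1+st²)^{-p} = O(L^{-(d-α+1)j})`. This follows from estimates
like those used previously, using `ρ(s,m²) ≲ s^{-α/2}`" [`abs_setIntegral_Ioc_selfSimilarError_le`].
(The restriction `α < d` of the paper is not needed for this lemma; the mass is unrestricted because
`ρ(s,m²) ≤ s^{-α/2}/(π sin(πα/2))` uniformly in `m²`.)
[cite: Slade2017, Lemma 10.3.1 (display (10.41)) and its proof, §10.3] -/
theorem Slade2017_lem1031 (hd : 1 ≤ d) {α : ℝ} (hα0 : 0 < α) (hα2 : α < 2) {L : ℝ} (hL : 2 ≤ L) :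
    ∃ C : ℝ, 0 < C ∧ ∀ j : ℕ, 2 ≤ j → ∀ m2 : ℝ, ∀ x : Site d,
      |fracCov d L α m2 j x -
        (L ^ j) ^ (α - d) * cZero d L α (fun i => (x i : ℝ) / L ^ j) (m2 * (L ^ j) ^ α)| ≤
        C * (L ^ j) ^ (α - d) * (L ^ j)⁻¹ := by
  have hd' : (1 : ℝ) ≤ d := by exact_mod_cast hd
  have hβ0 : 0 < α / 2 := by positivity
  have hβ1 : α / 2 < 1 := by linarith
  have hL1 : (1 : ℝ) ≤ L := by linarith
  have hL0 : (0 : ℝ) < L := by linarith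
  obtain ⟨C₁, hC₁, hE1⟩ := abs_setIntegral_Ioc_selfSimilarError_le hd hβ0 hβ1
  obtain ⟨C₂, hC₂, hE2⟩ := abs_setIntegral_Ioi_one_Gam_mul_le hd hβ0 hβ1
  obtain ⟨C₃, hC₃, hE3⟩ := abs_setIntegral_Ioi_cZeroKer_mul_le hd hL1 hβ0 hβ1
  obtain ⟨K, hK, hG⟩ := abs_cZeroKer_le hd hL1 0
  have hsin : 0 < Real.sin (π * (α / 2)) := Real.sin_pos_of_pos_of_lt_pi (by positivity)
    (by nlinarith [Real.pi_pos])
  obtain ⟨Lf, hLf⟩ : ∃ z : ℝ, z = L ^ ((1 : ℝ) - (α - d)) := ⟨_, rfl⟩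
  have hLf0 : 0 < Lf := by rw [hLf]; exact Real.rpow_pos_of_pos hL0 _
  refine ⟨(C₁ * (L - 1) + C₂) * Lf + C₃ + 1, by positivity, fun j hj m2 x => ?_⟩
  -- scales `ℓ = L^{j-1}`, `Λ = L^j = ℓL`
  obtain ⟨ℓ, hℓ⟩ : ∃ z : ℝ, z = L ^ (j - 1) := ⟨_, rfl⟩
  have hℓ1 : 1 ≤ ℓ := by rw [hℓ]; exact one_le_pow₀ hL1
  have hℓ2 : 2 ≤ ℓ := le_trans hL (by rw [hℓ]; exact le_self_pow₀ hL1 (by omega))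
  have hℓ0 : 0 < ℓ := by linarith
  obtain ⟨Λ, hΛ⟩ : ∃ z : ℝ, z = L ^ j := ⟨_, rfl⟩
  have hΛeq : Λ = ℓ * L := by rw [hΛ, hℓ, ← pow_succ, Nat.sub_add_cancel (by omega)]
  have hΛ0 : 0 < Λ := by rw [hΛeq]; positivity
  have hΛ1 : 1 ≤ Λ := by rw [hΛ]; exact one_le_pow₀ hL1
  have hΛ2 : 0 < Λ ^ 2 := by positivity
  rw [← hΛ]
  set y : Fin d → ℝ := fun i => (x i : ℝ) / Λ with hy
  -- powers of `Λ`
  have hΛα : (Λ ^ 2) ^ (α / 2) = Λ ^ α := by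
    rw [show (Λ ^ 2 : ℝ) = Λ ^ (2 : ℝ) by norm_cast, ← Real.rpow_mul hΛ0.le]
    ring_nf
  have hR1 : (Λ ^ 2)⁻¹ * (Λ ^ 2) ^ (α / 2) * (Λ ^ 2 / Λ ^ d) = Λ ^ (α - d) := by
    rw [hΛα, Real.rpow_sub hΛ0, Real.rpow_natCast]
    field_simp
  -- (S1) pointwise decomposition of `Γ_j` on `(0,1]`
  obtain ⟨main, hmain⟩ : ∃ f : ℝ → ℝ, ∀ s, f s = Λ ^ 2 / Λ ^ d * cZeroKer d L y (s * Λ ^ 2) :=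
    ⟨_, fun _ => rfl⟩
  obtain ⟨err, herr⟩ : ∃ f : ℝ → ℝ, ∀ s,
      f s = ∫ t in Ioc (ℓ / 2) (ℓ * L / 2), (wKer d s t x - wKerCont0 d s t x) / t := ⟨_, fun _ => rfl⟩
  have hS1 : ∀ s : ℝ, 0 < s → s ≤ 1 → Gam d L s j x = main s + err s := by
    intro s hs hs1
    rw [Slade2017_display106 L s hj x, ← hℓ, ← hΛ, hmain s, herr s]
    have hJ2 : Ioc (ℓ / 2) (ℓ * L / 2) = Ioc (Λ / (2 * L)) (Λ / 2) := by
      rw [hΛeq]; congr 1; field_simp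
    have hJ1 : Ioc (ℓ / 2) (Λ / 2) = Ioc (ℓ / 2) (ℓ * L / 2) := by rw [hΛeq]
    rw [hJ1]
    have hw := integrableOn_wKer_div_Ioc hs x (by positivity : (0 : ℝ) ≤ ℓ / 2) (b := ℓ * L / 2)
    have hw0 := integrableOn_wKerCont0_div_Ioc hd hs hs1 x (by linarith : (1 : ℝ) ≤ ℓ / 2)
      (b := ℓ * L / 2)
    have hw' : IntegrableOn (fun t : ℝ => wKer d s t x / t - wKerCont0 d s t x / t)
        (Ioc (ℓ / 2) (ℓ * L / 2)) := hw.sub hw0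
    have e1 : ∫ t in Ioc (ℓ / 2) (ℓ * L / 2), wKer d s t x / t =
        ∫ t in Ioc (ℓ / 2) (ℓ * L / 2), (wKerCont0 d s t x / t + (wKer d s t x / t - wKerCont0 d s t x / t)) :=
      integral_congr_ae (Eventually.of_forall fun t => by ring)
    rw [e1, integral_add hw0 hw']
    congr 1
    · rw [hJ2]
      exact setIntegral_wKerCont0_div_eq hd hs.le hΛ0 hL1 x
    · exact integral_congr_ae (Eventually.of_forall fun t => by ring)
  -- integrability
  have hint := integrableOn_Gam_mul_katoDensity_of_two_le hd hβ0 hβ1 hL hj m2 x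
  have hmainint : IntegrableOn (fun s : ℝ => main s * Kato.katoDensity (α / 2) m2 s) (Ioc 0 1) := by
    have hme : Measurable main := by
      have : main = fun s => Λ ^ 2 / Λ ^ d * cZeroKer d L y (s * Λ ^ 2) := funext hmain
      rw [this]
      exact ((measurable_cZeroKer L y).comp (measurable_id.mul_const _)).const_mul _
    have hmeas : AEStronglyMeasurable (fun s : ℝ => main s * Kato.katoDensity (α / 2) m2 s)
        ((volume : Measure ℝ).restrict (Ioc 0 1)) :=
      (hme.mul (Kato.measurable_katoDensity _ m2)).aestronglyMeasurable
    have hmaj : IntegrableOn (fun s : ℝ => Λ ^ 2 / Λ ^ d * K * (π * Real.sin (π * (α / 2)))⁻¹ * s ^ (-(α / 2)))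
        (Ioc (0 : ℝ) 1) :=
      (CovBound.integrableOn_rpow_Ioc_zero (by linarith : (-1 : ℝ) < -(α / 2)) zero_le_one).const_mul _
    refine Integrable.mono' hmaj hmeas ((ae_restrict_iff' measurableSet_Ioc).2
      (Eventually.of_forall fun s hs => ?_))
    have hρ0 := (Kato.katoDensity_pos hβ0 hβ1 m2 hs.1).le
    rw [Real.norm_eq_abs, abs_mul, abs_of_nonneg hρ0, hmain s, abs_mul,
      abs_of_nonneg (by positivity : (0 : ℝ) ≤ Λ ^ 2 / Λ ^ d)]
    have h1 := (hG (s * Λ ^ 2) (mul_nonneg hs.1.le hΛ2.le) y).2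
    rw [pow_zero, inv_one, mul_one] at h1
    have h2 := katoDensity_le_const_mul_rpow_neg hβ0 hβ1 m2 hs.1
    calc Λ ^ 2 / Λ ^ d * |cZeroKer d L y (s * Λ ^ 2)| * Kato.katoDensity (α / 2) m2 s
        ≤ Λ ^ 2 / Λ ^ d * K * ((π * Real.sin (π * (α / 2)))⁻¹ * s ^ (-(α / 2))) :=
          mul_le_mul (mul_le_mul_of_nonneg_left h1 (by positivity)) h2 hρ0 (by positivity)
      _ = _ := by ring
  -- (S0) split of `C_j` at `s = 1`
  have hS0 : fracCov d L α m2 j x = (∫ s in Ioc 0 1, Gam d L s j x * Kato.katoDensity (α / 2) m2 s) +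
      ∫ s in Ioi 1, Gam d L s j x * Kato.katoDensity (α / 2) m2 s := by
    unfold fracCov
    have hdj : Disjoint (Ioc (0 : ℝ) 1) (Ioi 1) :=
      Set.disjoint_left.2 fun s hs hs' => not_lt.2 hs.2 hs'
    rw [← Ioc_union_Ioi_eq_Ioi zero_le_one, setIntegral_union hdj measurableSet_Ioi
      (hint.mono_set Ioc_subset_Ioi_self) (hint.mono_set (Ioi_subset_Ioi zero_le_one))]
  -- (S2) the `(0,1]` part: main + error
  have hS2 : ∫ s in Ioc 0 1, Gam d L s j x * Kato.katoDensity (α / 2) m2 s =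
      (∫ s in Ioc 0 1, main s * Kato.katoDensity (α / 2) m2 s) +
        ∫ s in Ioc 0 1, err s * Kato.katoDensity (α / 2) m2 s := by
    have hG1 := hint.mono_set (Ioc_subset_Ioi_self : Ioc (0 : ℝ) 1 ⊆ Ioi 0)
    have hG2 : IntegrableOn (fun s : ℝ => Gam d L s j x * Kato.katoDensity (α / 2) m2 s -
        main s * Kato.katoDensity (α / 2) m2 s) (Ioc 0 1) := hG1.sub hmainint
    have e1 : ∫ s in Ioc 0 1, Gam d L s j x * Kato.katoDensity (α / 2) m2 s =
        ∫ s in Ioc 0 1, (main s * Kato.katoDensity (α / 2) m2 s +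
          (Gam d L s j x * Kato.katoDensity (α / 2) m2 s - main s * Kato.katoDensity (α / 2) m2 s)) :=
      integral_congr_ae (Eventually.of_forall fun s => by ring)
    rw [e1, integral_add hmainint hG2]
    congr 1
    refine setIntegral_congr_fun measurableSet_Ioc fun s hs => ?_
    rw [hS1 s hs.1 hs.2]
    ring
  -- (S3) the substitution `s = σΛ^{-2}` in the main part
  have hS3 : ∫ s in Ioc 0 1, main s * Kato.katoDensity (α / 2) m2 s =
      Λ ^ (α - d) * ∫ σ in Ioc 0 (Λ ^ 2), cZeroKer d L y σ * Kato.katoDensity (α / 2) (m2 * Λ ^ α) σ := by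
    have h := setIntegral_comp_mul_katoDensity_eq hβ0 hβ1 m2 hΛ0
      (fun σ => Λ ^ 2 / Λ ^ d * cZeroKer d L y σ)
    have e1 : (fun s => main s * Kato.katoDensity (α / 2) m2 s) =
        fun s => (fun σ => Λ ^ 2 / Λ ^ d * cZeroKer d L y σ) (s * Λ ^ 2) * Kato.katoDensity (α / 2) m2 s := by
      funext s; rw [hmain s]
    rw [e1, h, show m2 * (Λ ^ 2) ^ (α / 2) = m2 * Λ ^ α by rw [hΛα]]
    have e2 : ∫ σ in Ioc 0 (Λ ^ 2), (fun σ => Λ ^ 2 / Λ ^ d * cZeroKer d L y σ) σ *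
        Kato.katoDensity (α / 2) (m2 * Λ ^ α) σ =
        Λ ^ 2 / Λ ^ d * ∫ σ in Ioc 0 (Λ ^ 2), cZeroKer d L y σ * Kato.katoDensity (α / 2) (m2 * Λ ^ α) σ := by
      rw [← integral_const_mul]
      exact integral_congr_ae (Eventually.of_forall fun σ => by ring)
    rw [e2, ← hR1]
    ring
  -- (S4) split of `c₀` at `σ = Λ²`
  have hcint := integrableOn_cZeroKer_mul_katoDensity hd hL1 hβ0 hβ1 (m2 * Λ ^ α) y
  have hS4 : cZero d L α y (m2 * Λ ^ α) =
      (∫ σ in Ioc 0 (Λ ^ 2), cZeroKer d L y σ * Kato.katoDensity (α / 2) (m2 * Λ ^ α) σ) +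
        ∫ σ in Ioi (Λ ^ 2), cZeroKer d L y σ * Kato.katoDensity (α / 2) (m2 * Λ ^ α) σ := by
    unfold cZero
    have hdj : Disjoint (Ioc (0 : ℝ) (Λ ^ 2)) (Ioi (Λ ^ 2)) :=
      Set.disjoint_left.2 fun s hs hs' => not_lt.2 hs.2 hs'
    rw [← Ioc_union_Ioi_eq_Ioi hΛ2.le, setIntegral_union hdj measurableSet_Ioi
      (hcint.mono_set Ioc_subset_Ioi_self) (hcint.mono_set (Ioi_subset_Ioi hΛ2.le))]
  -- the three error bounds
  have hB1 : |∫ s in Ioc 0 1, err s * Kato.katoDensity (α / 2) m2 s| ≤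
      C₁ * (L - 1) * Lf * (Λ ^ (α - d) * Λ⁻¹) := by
    have h := hE1 L hL ℓ hℓ2 m2 x
    have e : (fun s => err s * Kato.katoDensity (α / 2) m2 s) = fun s =>
        (∫ t in Ioc (ℓ / 2) (ℓ * L / 2), (wKer d s t x - wKerCont0 d s t x) / t) *
          Kato.katoDensity (α / 2) m2 s := by
      funext s; rw [herr s]
    rw [e]
    refine h.trans (le_of_eq ?_)
    rw [mul_assoc (C₁ * (L - 1)), div_pow_mul_sq_rpow_eq hℓ0,
      show (2 * (α / 2) - d - 1 : ℝ) = (α - d) - 1 by ring, rpow_sub_one_eq_of_mul hℓ0 hL0, ← hΛeq, hLf]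
    ring
  have hB2 : |∫ s in Ioi 1, Gam d L s j x * Kato.katoDensity (α / 2) m2 s| ≤
      C₂ * Lf * (Λ ^ (α - d) * Λ⁻¹) := by
    have h := hE2 L hL j hj m2 x
    rw [← hℓ] at h
    refine h.trans ?_
    rw [pow_four_inv_mul_eq hℓ0, mul_assoc]
    refine mul_le_mul_of_nonneg_left ?_ hC₂.le
    calc ℓ ^ (-(2 : ℝ) - d) ≤ ℓ ^ ((α - d) - 1) := Real.rpow_le_rpow_of_exponent_le hℓ1 (by linarith)
      _ = Lf * (Λ ^ (α - d) * Λ⁻¹) := by rw [rpow_sub_one_eq_of_mul hℓ0 hL0, ← hΛeq, hLf]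
  have hB3 : |Λ ^ (α - d) * ∫ σ in Ioi (Λ ^ 2), cZeroKer d L y σ * Kato.katoDensity (α / 2) (m2 * Λ ^ α) σ| ≤
      C₃ * (Λ ^ (α - d) * Λ⁻¹) := by
    have h := hE3 (m2 * Λ ^ α) y (Λ ^ 2) (one_le_pow₀ hΛ1)
    have hp0 : 0 < Λ ^ (α - d) := Real.rpow_pos_of_pos hΛ0 _
    rw [abs_mul, abs_of_pos hp0]
    have h2 : (Λ ^ 2) ^ (-1 - α / 2) ≤ Λ⁻¹ := by
      rw [show (Λ ^ 2 : ℝ) = Λ ^ (2 : ℝ) by norm_cast, ← Real.rpow_mul hΛ0.le, ← Real.rpow_neg_one]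
      exact Real.rpow_le_rpow_of_exponent_le hΛ1 (by linarith)
    calc Λ ^ (α - d) * |∫ σ in Ioi (Λ ^ 2), cZeroKer d L y σ * Kato.katoDensity (α / 2) (m2 * Λ ^ α) σ|
        ≤ Λ ^ (α - d) * (C₃ * (Λ ^ 2) ^ (-1 - α / 2)) := mul_le_mul_of_nonneg_left h hp0.le
      _ ≤ Λ ^ (α - d) * (C₃ * Λ⁻¹) := by gcongr
      _ = C₃ * (Λ ^ (α - d) * Λ⁻¹) := by ring
  -- assemble
  have hdiff : fracCov d L α m2 j x - Λ ^ (α - d) * cZero d L α y (m2 * Λ ^ α) =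
      (∫ s in Ioc 0 1, err s * Kato.katoDensity (α / 2) m2 s) +
        (∫ s in Ioi 1, Gam d L s j x * Kato.katoDensity (α / 2) m2 s) -
        Λ ^ (α - d) * ∫ σ in Ioi (Λ ^ 2), cZeroKer d L y σ * Kato.katoDensity (α / 2) (m2 * Λ ^ α) σ := by
    rw [hS0, hS2, hS3, hS4]
    ring
  have hX : 0 ≤ Λ ^ (α - d) * Λ⁻¹ := by
    have := Real.rpow_pos_of_pos hΛ0 (α - d)
    positivity
  rw [hdiff]
  calc |(∫ s in Ioc 0 1, err s * Kato.katoDensity (α / 2) m2 s) +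
        (∫ s in Ioi 1, Gam d L s j x * Kato.katoDensity (α / 2) m2 s) -
        Λ ^ (α - d) * ∫ σ in Ioi (Λ ^ 2), cZeroKer d L y σ * Kato.katoDensity (α / 2) (m2 * Λ ^ α) σ|
      ≤ |∫ s in Ioc 0 1, err s * Kato.katoDensity (α / 2) m2 s| +
          |∫ s in Ioi 1, Gam d L s j x * Kato.katoDensity (α / 2) m2 s| +
          |Λ ^ (α - d) * ∫ σ in Ioi (Λ ^ 2), cZeroKer d L y σ * Kato.katoDensity (α / 2) (m2 * Λ ^ α) σ| := by
        refine (abs_sub _ _).trans ?_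
        exact add_le_add (abs_add_le _ _) le_rfl
    _ ≤ C₁ * (L - 1) * Lf * (Λ ^ (α - d) * Λ⁻¹) + C₂ * Lf * (Λ ^ (α - d) * Λ⁻¹) + C₃ * (Λ ^ (α - d) * Λ⁻¹) :=
        add_le_add (add_le_add hB1 hB2) hB3
    _ = ((C₁ * (L - 1) + C₂) * Lf + C₃) * Λ ^ (α - d) * Λ⁻¹ := by ring
    _ ≤ ((C₁ * (L - 1) + C₂) * Lf + C₃ + 1) * Λ ^ (α - d) * Λ⁻¹ := by
        rw [mul_assoc, mul_assoc]
        exact mul_le_mul_of_nonneg_right (by linarith) hX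

end FRD

end LongRangePhi4

end Literature.Barriers.CriticalPhenomena
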